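import Literature.NumberTheory.Automorphic.Arthur2013.Leaves.TorusCyclotomic
import HarnessLib

/-!
# Arthur (2013) audit, typed leaves — §45.38 THE CYCLOTOMIC CM PAIRS FOR `Ġ = T` (continued): LEMMERMEYER'S PROPOSITION 1 h) — THE SUBFIELDS OF `ℚ(ζ_{2^μ})` CONTAINING `√-1` ARE THE `ℚ(ζ_{2^α})`; `ℚ(ζ_m)ℚ(ζ_n) = ℚ(ζ_{mn})`; `Q(K₁K₂) = 2` AND `κ = 1` FOR COMPOSITA OF CM SUBFIELDS OF `ℚ(ζ_{p^μ})`, `ℚ(ζ_{q^ν})` IN AN ARBITRARY AMBIENT NUMBER FIELD — ALL CASES: `p, q` ODD; `p = 2` WITH `√-1 ∈ K₁`; `p = 2` WITH `√-1 ∉ K₁` THROUGH PROPOSITION 1 e) AND THE NORM `N(ζ_{2^α}) = -1`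

(M115, v1.1 = v1 + item (12), items (10), (11) byte-identical; a new leaf of the cell's `Leaves/` tree importing M113 `TorusCyclotomic` — hence M112 `TorusSignatures`,
M109 `TorusConstellations`, M107 `TorusUnits`, M104 `TorusOddPlaces`, M101, M99, M97, M92, M86, M78 transitively —;
same namespace `…Leaves.TECR.TorusDict`; items are numbered (10)–(12) in continuation of M113's (0)–(9).  M113 v1.6
stands at 88 % of the file-size cap, whence a new module rather than M113 v1.7.  Every lineage module is left
byte-identical.  0 `def`, 0 `sorry`, no named fact: every hypothesis is a binder or an instance.)

SETTING (M107 §45.34, M109 §45.35, M113 §45.37).  For `Ġ = T = U(1)_{Ė/Ḟ}` the Book's requirement on `Ż_{∞,u}`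
([Ar] d-p.310, quoted in M86–M113) restricts the local data beyond the squares exactly in the regime `Q(Ė) = 2 ∨ κ ≠ 1`
(M107/M109).  M113 read that regime off `n` for `Ė = ℚ(ζ_n)` (Proposition 1 g), Examples 1, 2) and proved
Lemmermeyer's Proposition 1 h) — `Q(K₁K₂) = 2` for composita of CM subfields `K₁ ⊆ ℚ(ζ_{p^μ})`, `K₂ ⊆ ℚ(ζ_{q^ν})` —
in the odd case INSIDE `M = ℚ(ζ_{p^μ q^ν})`, and for `p = 2` only with `K₁ = ℚ(ζ_{2^α})` given as the cyclotomic
intermediate field of `M` (M113 item (9), (D77)).  This module supplies the two classical facts that remove those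
restrictions and re-proves h) in Lemmermeyer's own generality — the odd case and the first sub-case of `p = 2` in
item (11), the second sub-case `√-1 ∉ K₁` and hence h) IN FULL in item (12):

 (10) LEMMERMEYER'S REMARK « complex subfields of the field of $2^\mu$th roots of unity containing $\sqrt{-1}$
      necessarily have this form » (`eq_adjoin_zeta_pow_of_sq_eq_neg_one`,
      `exists_isCyclotomicExtension_two_pow_of_sq_eq_neg_one`, `exists_isCyclotomicExtension_two_pow_sup_adjoin`;
      (D78)).  `L` `{2^μ}`-cyclotomic over `ℚ`, `μ = k + 2 ≥ 2`, `ζ` Mathlib's primitive root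
      (`IsCyclotomicExtension.zeta`), `K : IntermediateField ℚ L` containing some `x` with `x² = -1`: then
      `K = ℚ(ζ^(2^j))` for some `j ≤ k`, so `K` is `{2^α}`-cyclotomic over `ℚ` with `2 ≤ α = μ - j ≤ μ`; and for ANY
      `K` and `i ∈ L` with `i² = -1`, `K(i) = K ⊔ ℚ(i)` is `{2^α}`-cyclotomic, `2 ≤ α ≤ μ` (the step
      « $\widetilde{K}_1 = K_1(i)$; then $\widetilde{K}_1 = \Q(\zeta_m)$ » of the second sub-case).  Proof (the paper
      gives none): `x = ±ζ^(2^k)`, so `ℚ(i) ≤ K` with `i = ζ^(2^k)`, `(L : ℚ(i)) = 2^k`; `Gal(L/ℚ(i))` contains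
      `σ₅ : ζ ↦ ζ⁵` (`IsCyclotomicExtension.fromZetaAut`) whose order is the order `2^k` of `5` in `(ℤ/2^(k+2))ˣ`
      (`ZMod.orderOf_five`), hence is CYCLIC `= ⟨σ₅⟩`; a cyclic group has one subgroup of each order, so `Gal(L/K)`
      (order `2^j ∣ 2^k`) equals `Gal(L/ℚ(ζ^(2^j)))`, and the Galois correspondence (`IsGalois.fixedField_fixingSubgroup`)
      gives `K = ℚ(ζ^(2^j))`.
 (11) PROPOSITION 1 h) IN AN ARBITRARY AMBIENT NUMBER FIELD (`isCyclotomicExtension_sup_of_coprime`;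
      `isCMField_sup_of_cyclotomic'`, `indexRealUnits_sup_eq_two_of_cyclotomic'`,
      `ker_classGroupExtendedHom_maximalRealSubfield_sup_eq_bot_of_cyclotomic'`; their `twoPow` versions; and
      `isCMField_sup_of_sq_eq_neg_one`, `indexRealUnits_sup_eq_two_of_sq_eq_neg_one`,
      `ker_classGroupExtendedHom_maximalRealSubfield_sup_eq_bot_of_sq_eq_neg_one`; (D79)).  `M` is ANY number field;
      `Lm, Ln : IntermediateField ℚ M` are `{p^μ}`- resp. `{q^ν}`-cyclotomic over `ℚ` (copies of `ℚ(ζ_{p^μ})`,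
      `ℚ(ζ_{q^ν})` inside `M`; `p ≠ q` primes, `μ, ν > 0`); `K₁ ≤ Lm`, `K₂ ≤ Ln` are totally complex (e.g. CM — the
      instance `IsCMField → IsTotallyComplex`); `K₁K₂ = K₁ ⊔ K₂`.  (11a) `ℚ(ζ_m)ℚ(ζ_n) = ℚ(ζ_{mn})`: for coprime
      `m, n > 1` and `{m}`-, `{n}`-cyclotomic intermediate fields `A, B` of `M`, `A ⊔ B` is `{mn}`-cyclotomic over `ℚ`
      (« $K_1(\zeta_n) = \Q(\zeta_{mn})$ »).  (11b)–(11d) `p, q` ODD: `K₁ ⊔ K₂` is CM, `Q(K₁ ⊔ K₂) = 2`,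
      `κ_{K₁K₂/(K₁K₂)⁺} = 1`.  (11e)–(11g) `p = 2` with `K₁` ITSELF `{2^α}`-cyclotomic over `ℚ`, `α ≥ 2` (any
      intermediate field of `M`; no `Lm`): the same three conclusions.  (11h)–(11j) `p = 2`, LEMMERMEYER'S SUB-CASE
      `√-1 ∈ K₁` VERBATIM: `K₁ ≤ Lm` with `Lm` `{2^μ}`-cyclotomic, `μ ≥ 2`, and some `x ∈ K₁` with `x² = -1`: the same
      three conclusions (by (10), `K₁` is `{2^α}`-cyclotomic, `2 ≤ α ≤ μ`; then (11e)–(11g)).  Engine, as in M113 (9)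
      but relative to `A ⊔ B ≤ M` ((D79)): a `ℚ`-involution of `A ⊔ B` fixing `K₁ ⊔ K₂` pointwise fixes `A` and `B`
      (restriction into the odd-order groups `Gal(Lm/K₁)`, `Gal(Ln/K₂)`, M113 item (7b); for `A = K₁` trivially),
      hence is the identity; so `(A ⊔ B : K₁ ⊔ K₂)` is odd, and M113 items (7a), (7f), (7g) (Proposition 1 f), g), b))
      apply inside the `{2^α q^ν}`- resp. `{p^μ q^ν}`-cyclotomic field `A ⊔ B` ((11a)).

 (12) PROPOSITION 1 h) IN FULL (`isCMField_sup_of_le_cyclotomic`, `indexRealUnits_sup_eq_two_of_le_twoPow_cyclotomic`,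
      `indexRealUnits_sup_eq_two_of_le_primePow_cyclotomic`,
      `ker_classGroupExtendedHom_maximalRealSubfield_sup_eq_bot_of_le_primePow_cyclotomic`; (D82)).  Setting of (11)
      (`M` any number field, `Lm, Ln ≤ M` `{p^μ}`-, `{q^ν}`-cyclotomic, `p ≠ q` primes, `μ, ν > 0`, `K₁ ≤ Lm`,
      `K₂ ≤ Ln`).  (12a) `K₁` totally complex ⇒ `K₁ ⊔ K₂` is CM (ANY `p ≠ q`: a totally complex subfield of the abelian
      field `Lm ⊔ Ln` — (11a) —; Mathlib's `IsCMField.of_isAbelianGalois`).  (12b) `p = 2`, `μ ≥ 2`, `q` odd, `K₁`,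
      `K₂` totally complex ⇒ `Q(K₁ ⊔ K₂) = 2` — BOTH sub-cases: `√-1 ∈ K₁` is (11i); for `√-1 ∉ K₁` (private engine
      `indexRealUnits_sup_eq_two_of_not_sq_tct`) let `i = ζ_{2^μ}^(2^(μ-2)) ∈ Lm`, `K̃₁ = K₁(i) = K₁ ⊔ ℚ(i)`
      (`{2^α}`-cyclotomic, `2 ≤ α ≤ μ`, (10c)/(11θ)), `K = K₁ ⊔ K₂ ≤ L = K̃₁ ⊔ K₂`; then `Q(L) = 2` ((11f)),
      `i ∉ K` (degrees: `[K̃₁ ⊔ Ln : ℚ] = φ(2^α)φ(q^ν) = 2[K₁ : ℚ][Ln : ℚ] > [K₁ ⊔ Ln : ℚ]`), so `L = K(i)` is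
      Galois over `K` of degree `2`, `Gal(L/K) = {1, τ}`; `N_{L/K}(ζ_{2^α})` is a `2`-power root of unity of `K ∌ i`,
      hence `= ±1`, and `+1` is impossible — it would give `τ ζ_{2^α} = ζ_{2^α}⁻¹`, so that `τ|K̃₁` is complex
      conjugation under every complex embedding (`IsPrimitiveRoot.powerBasis`: a `ℚ`-map out of `K̃₁` is determined on
      `ζ_{2^α}`) while fixing the totally complex `K₁` pointwise —; so `N_{L/K}(ζ_{2^α}) = -1`, which is not the
      square of a root of unity of `K` (« $N(\zeta_m) = -1$, and $-1$ generates $W^{}_{K_1}/W_{K_1}^2$ »), and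
      Proposition 1 e) (M113 item (6e) `indexRealUnits_eq_two_of_tower_of_norm`) transfers `Q(L) = 2` to
      `Q(K) = 2`.  (12c) h) AS STATED, all cases at once: `p ≠ q` primes labelled so that `q ≠ 2`, `μ, ν > 0`, `K₁`,
      `K₂` totally complex ⇒ `Q(K₁ ⊔ K₂) = 2` (`p` odd: (11c); `p = 2`: then `μ ≥ 2` since `K₁ ≤ ℚ(ζ_2) = ℚ` cannot
      be totally complex, and (12b)).  (12d) `κ_{K₁K₂/(K₁K₂)⁺} = 1` in the same generality (Proposition 1 b), M107).

WHAT THIS DECIDES FOR THE AUDIT (cell GAPS.md §TY-34).  For `Ġ = T` and the CM pairs `(Ė, Ė⁺)` with `Ė = K₁K₂` a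
compositum of CM subfields of `ℚ(ζ_{p^μ})` and `ℚ(ζ_{q^ν})` (`p ≠ q` ANY two primes, `μ, ν > 0`), wherever `K₁`, `K₂`
are realised (any ambient number field): `Q(Ė) = 2` and `κ_{Ė/Ė⁺} = 1` (item (12c), (12d)).  So every such pair lies in the
regime `Q(Ė) = 2 ∨ κ ≠ 1` of M107/M109 in which the d-p.310 requirement DOES restrict the local data beyond the squares
(existence = the joint condition H(V) for every `V`, GW(∅); M109, M113 item (1)), decided by the primes `p, q` alone and
with no class-number input.  M113's (D77) restriction to the ambient `ℚ(ζ_{p^μ q^ν})` and to `K₁ = ℚ(ζ_{2^α})` is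
lifted, and Proposition 1 h) is typed in full ((D80), (D82)); Lemmermeyer's Example 4 (« see Example 4 below ») is not
needed for, and not typed by, this leaf.

THE TEXT.  [Ar] d-p.310 as quoted in M86–M113 (the requirement on `\dot f^u_\infty \dot f_u`; not re-quoted here).
Lemmermeyer 1995, §2, Proposition 1: « h) (see Example 4 below) Let $K_1 \subseteq \Q(\zeta_m)$ and
$K_2 \subseteq \Q(\zeta_n)$ be abelian CM-fields, where $m=p^\mu$
and $n=q^\nu$ are prime powers such that $p \ne q$, and let
$K = K_1K_2$; then $Q(K) = 2$. »  Its proof, odd case: « Since $(\Q(\zeta_m):K_1)$ and $(\Q(\zeta_n):K_2)$ are both odd, so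
is $(\Q(\zeta_{mn}):K_1K_2)$; moreover, $\Q(\zeta_{mn})$ has unit
index $Q = 2$, hence the assertion follows from f) and g). »  Case `p = 2`: « Now assume that $p=2$. If $\sqrt{-1} \in K_1$, then we must have
$K_1 = \Q(\zeta_m)$ for $m=2^\alpha$ and some $\alpha \ge 2$
(complex subfields of the field of $2^\mu$th roots of unity
containing $\sqrt{-1}$ necessarily have this form). Now $n$ is
odd and $K_2 \subseteq \Q(\zeta_n)$ is complex, hence
$(\Q(\zeta_n):K_2)$ is odd. By f) it suffices to show that
$K_1(\zeta_n) = \Q(\zeta_{mn})$ has unit index $2$, and this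
follows from g). »  The second sub-case: « If $\sqrt{-1} \not\in K_1$, let $\widetilde{K}_1 = K_1(i)$;
then $\widetilde{K}_1 = \Q(\zeta_m)$ for $m=2^\alpha$ and some
$\alpha \ge 2$, and in the last paragraph we have seen that
$Q(\widetilde{K}_1K_2) = 2$. Hence we only need to show that the
norm map » (`N : W_{K̃₁}/W_{K̃₁}² → W_{K₁}/W_{K₁}²`) « is onto: since $(W_{\widetilde{K}_1K_2}:W_{\widetilde{K}_1})$ is odd,
this implies $2 = Q(\widetilde{K}_1K_2) \mid Q(K_1K_2)$ by e). But
the observation that the non-trivial automorphism of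
$\Q(\zeta_m)/K_1$ maps $\zeta_m$ to $-\zeta_m^{-1}$ implies
at once that $N(\zeta_m) = -1$, and $-1$ generates
$W^{}_{K_1}/W_{K_1}^2$. »  Proposition 1 e): « e) (compare Satz 26) Suppose that
$N_{L/K}: \, W_L/W_L^2 \to W^{}_K/W_K^2$ is onto.
	Then $Q(L) \mid Q(K)$. » (typed, with Lemmermeyer's proof, as M113 item (6e)).

DIVERGENCES (continuing M113 (D70)–(D77)).
(D78) « complex subfields of the field of $2^\mu$th roots of unity containing $\sqrt{-1}$ ».  TYPED: `L` a number
field with `[IsCyclotomicExtension {2^μ} ℚ L]` (`μ = k + 2`, resp. `2 ≤ μ`), `K : IntermediateField ℚ L`, and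
« containing $\sqrt{-1}$ » as `∃ x ∈ K, x ^ 2 = -1`; “complex” is then automatic and is not a hypothesis.  « have this
form » (`= ℚ(ζ_{2^α})`, `α ≥ 2`) is typed twice: as the EQUALITY `K = ℚ⟮ζ^(2^j)⟯` of intermediate fields of `L`
(`ζ = IsCyclotomicExtension.zeta (2^(k+2)) ℚ L`, `j ≤ k`; `ζ^(2^j)` is a primitive `2^(k+2-j)`-th root of unity), and
as the STRUCTURE `IsCyclotomicExtension {2^α} ℚ ↥K` with `2 ≤ α ≤ μ` — the form consumed by item (11).  Lemmermeyer
gives no proof; ours (item (10)) is the Galois correspondence plus the cyclicity of `Gal(ℚ(ζ_{2^μ})/ℚ(i)) = ⟨σ₅⟩`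
(`ZMod.orderOf_five`: `5` has order `2^k` modulo `2^(k+2)`) and the uniqueness of a subgroup of given order in a finite
cyclic group (a private lemma, from `IsCyclic.card_pow_eq_one_le`).
(D79) THE AMBIENT FIELD OF PROPOSITION 1 h).  The paper's `K₁K₂`, `K₁(ζ_n)`, `ℚ(ζ_{mn})` live in an unnamed common
overfield; M113 (9) took `M = ℚ(ζ_{mn})` itself (`{mn}`-cyclotomic) as that overfield.  TYPED here: `M` is ANY number
field, `Lm, Ln ≤ M` intermediate fields carrying `IsCyclotomicExtension {p^μ} ℚ ↥Lm`, `{q^ν} ℚ ↥Ln`, and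
`K₁K₂ = K₁ ⊔ K₂`, `K₁(ζ_n) = K₁ ⊔ Ln`, `ℚ(ζ_m)ℚ(ζ_n) = Lm ⊔ Ln`, the last two PROVED `{mn}`-cyclotomic (item (11a);
M113 (9β) had only `Lm ⊔ Ln = ⊤` inside `ℚ(ζ_{mn})`).  The odd relative index `(Lm ⊔ Ln : K₁ ⊔ K₂)` is an internal
step: the algebra structure `↥(K₁ ⊔ K₂) → ↥(Lm ⊔ Ln)` (the inclusion) is not a global instance, so the public
statements are the three invariant conclusions — `K₁ ⊔ K₂` is CM (instance supplied by `haveI` in the statements),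
`Q(K₁ ⊔ K₂) = 2`, `κ = 1` —, each for the odd case ((11b)–(11d)), for `K₁` `{2^α}`-cyclotomic ((11e)–(11g)), and for
`√-1 ∈ K₁ ≤ ℚ(ζ_{2^μ})` ((11h)–(11j)).  “abelian CM-fields” is weakened to totally complex (abelian is automatic inside
a cyclotomic field; CM ⟹ totally complex is the Mathlib instance, and conversely such `Kᵢ` ARE CM by M113 item (7c)
resp. item (11)).  `Q = 2` for `p = 2` needs `α ≥ 2`, i.e. `√-1 ∈ K₁`, exactly as in the paper.
(D80) SCOPE.  Typed: the classification remark (10) and Proposition 1 h) for arbitrary ambient fields — in v1 the odd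
case and the sub-case `√-1 ∈ K₁` of `p = 2` (item (11)), since v1.1 also the sub-case `√-1 ∉ K₁` and hence h) in
full (item (12)) —, with `κ = 1` (Proposition 1 b), M107) alongside.  The ingredients v1 listed as missing for the second
sub-case are supplied in item (12): `[K₁(i)K₂ : K₁K₂] = 2` (degree count), the behaviour of the non-trivial
automorphism on `ζ_{2^α}` (DERIVED, see (D82), not read off a classification of the index-`2` subfields), the norm
`N(ζ_{2^α}) = -1`, and Proposition 1 e) — which M113 item (6e) `indexRealUnits_eq_two_of_tower_of_norm` types in
general (`N_{L/K}(W_L) ⊄ W_K² ⇒ (Q(L) = 2 ⇒ Q(K) = 2)`; v1's phrase “only in its odd-index guise” was inaccurate: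
the odd-index form is f), item (6f)).  Example 3 and Proposition 1 c) are elsewhere (M112) or untyped, as recorded in
M113 (D70); Example 4 is not typed.
(D82) THE SECOND SUB-CASE, OUR ROUTE THROUGH e).  The paper norms from `K̃₁ = ℚ(ζ_m)` down to `K₁` and invokes
« $(W_{\widetilde{K}_1K_2}:W_{\widetilde{K}_1})$ is odd » to pass to the composita; TYPED: the norm is taken directly
in the quadratic extension `L = K̃₁K₂ ⊇ K = K₁K₂` (the `Algebra ↥(K₁ ⊔ K₂) ↥((K₁ ⊔ ℚ⟮i⟯) ⊔ K₂)` structure is the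
inclusion, built internally), to which e) = M113 (6e) applies verbatim with `ξ = ζ_{2^α} ∈ L`; the oddness of
`(W_L : W_{K̃₁})` is then not needed.  The paper's « observation that the non-trivial automorphism of
$\Q(\zeta_m)/K_1$ maps $\zeta_m$ to $-\zeta_m^{-1}$ » is not assumed from a classification but DERIVED inside the
proof: `N_{L/K}(ζ) = ζ · τζ` is a `2`-power root of unity in `K`, and `K ∌ i` has only `±1` such; `ζ · τζ = 1` would
make `τ|K̃₁` (the restriction `AlgEquiv.restrictNormal`, compared with complex conjugation through an arbitrary
embedding `K̃₁ → ℂ` on the power basis of `ζ`) a complex conjugation fixing the totally complex field `K₁`, which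
`NumberField.IsTotallyComplex` forbids; hence `τζ = -ζ⁻¹` and `N(ζ) = -1`.  The public statement (12b) carries no
case distinction (`by_cases` on `∃ x ∈ K₁, x² = -1` internally); (12c) assumes the labelling `q ≠ 2` of the two
distinct primes (one of them is odd), and excludes nothing else: for `p = 2` the hypothesis `μ ≥ 2` of (12b) is forced
by `K₁ ≤ ℚ(ζ_2) = ℚ` not being totally complex.  As in (D79), “abelian CM-fields” is weakened to totally complex
subfields (which are CM, (12a)).
(D81) SOURCES VERSUS CONTENT.  Proposition 1 h) is a PUBLISHED statement (Lemmermeyer 1995, Acta Arith. 72) RE-PROVED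
here over Mathlib's cyclotomic extensions (`IsCyclotomicExtension`, `IsPrimitiveRoot`, `IsCyclotomicExtension.fromZetaAut`,
`ZMod.orderOf_five`, `IsGalois.fixedField_fixingSubgroup`, `IntermediateField.lift`, `Algebra.norm_eq_prod_automorphisms`,
`IsPrimitiveRoot.powerBasis`, `AlgEquiv.restrictNormal`, `IsCMField.of_isAbelianGalois`) and M113 items (6e), (7a),
(7b), (7f), (7g); the classification remark is classical and stated without proof in the paper.  Nothing enters as a cited fact; the
Arthur manuscript is referred to for the requirement being analysed (through M113) and is not relied upon.

Sources: Arthur2011Draft [Ar] d-p.309/310 (Lemma 6.2.2, the condition on `Ż_{∞,u}`; via M86–M113); Lemmermeyer1995 =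
F. Lemmermeyer, *Ideal class groups of cyclotomic number fields I*, Acta Arith. 72 (1995) 347–359, §2 Proposition 1 b),
e), f), g), h) and the proof of h) (held: `paper:arxiv-1202.5777`); Mathlib (`IsCyclotomicExtension`,
`IsCyclotomicExtension.Rat`, `NumberTheory.Cyclotomic.Gal`, `RingTheory.ZMod.UnitsCyclic`, `FieldTheory.Galois.Basic`,
`IsCMField`, `maximalRealSubfield`).
-/

noncomputable section

open NumberField IntermediateField Polynomial

namespace Literature.NumberTheory.Automorphic.Arthur2013.Leaves.TECR.TorusDict

section TwoPowerSubfields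

/-! ### (10) Lemmermeyer's remark: the subfields of `ℚ(ζ_{2^μ})` containing `√-1` are the `ℚ(ζ_{2^α})` -/

variable {L : Type} [Field L] [NumberField L]

/-- [folklore] (proved here; private helper) Two subgroups of the same order inside a cyclic subgroup of a finite
group coincide (a cyclic group has at most `d` elements of order dividing `d`). -/
private theorem subgroup_eq_of_card_eq_tct {G : Type*} [Group G] [Finite G] {H A B : Subgroup G}
    [IsCyclic H] (hA : A ≤ H) (hB : B ≤ H) (h : Nat.card A = Nat.card B) : A = B := by
  classical
  haveI : Fintype G := Fintype.ofFinite G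
  have hd : 0 < Nat.card A := Nat.card_pos
  have key : ∀ C : Subgroup G, C ≤ H → Nat.card C = Nat.card A →
      (Finset.univ.filter fun x : H => (x : G) ∈ C) =
        (Finset.univ.filter fun x : H => x ^ Nat.card A = 1) := by
    intro C hC hcard
    apply Finset.eq_of_subset_of_card_le
    · intro x hx
      rw [Finset.mem_filter] at hx ⊢
      refine ⟨hx.1, ?_⟩
      have h1 : (⟨(x : G), hx.2⟩ : C) ^ Nat.card C = 1 := pow_card_eq_one'
      rw [hcard] at h1
      have h2 := congrArg Subtype.val h1
      simp only [SubgroupClass.coe_pow, OneMemClass.coe_one] at h2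
      exact Subtype.ext (by simpa using h2)
    · have e : C ≃ {x : H // (x : G) ∈ C} :=
        ⟨fun c => ⟨⟨c, hC c.2⟩, c.2⟩, fun x => ⟨x.1, x.2⟩, fun _ => rfl, fun _ => rfl⟩
      calc (Finset.univ.filter fun x : H => x ^ Nat.card A = 1).card
          ≤ Nat.card A := by (convert IsCyclic.card_pow_eq_one_le hd; infer_instance)
        _ = Nat.card C := hcard.symm
        _ = Nat.card {x : H // (x : G) ∈ C} := Nat.card_congr e
        _ = (Finset.univ.filter fun x : H => (x : G) ∈ C).card := by
            rw [Nat.card_eq_fintype_card]; convert Fintype.card_subtype _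
  have hAB := (key A hA rfl).trans (key B hB h.symm).symm
  ext g
  constructor
  · intro hg
    have hm : (⟨g, hA hg⟩ : H) ∈ Finset.univ.filter fun x : H => (x : G) ∈ A := by simp [hg]
    rw [hAB] at hm
    simpa using hm
  · intro hg
    have hm : (⟨g, hB hg⟩ : H) ∈ Finset.univ.filter fun x : H => (x : G) ∈ B := by simp [hg]
    rw [← hAB] at hm
    simpa using hm

/-- **(10a) LEMMERMEYER'S REMARK: A SUBFIELD OF `ℚ(ζ_{2^μ})` CONTAINING `√-1` IS `ℚ(ζ_{2^μ}^(2^j))`** (`μ = k + 2`;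
`L` `{2^(k+2)}`-cyclotomic over `ℚ` with Mathlib's primitive root `ζ = IsCyclotomicExtension.zeta (2^(k+2)) ℚ L`;
`K : IntermediateField ℚ L` containing some `x` with `x² = -1`).  Then `K = ℚ(ζ^(2^j))` for some `j ≤ k` — and
`ζ^(2^j)` is a primitive `2^(k+2-j)`-th root of unity, `k + 2 - j ≥ 2` ((10b)).  Proof ((D78); the paper gives none):
`x = ±ζ^(2^k)`, so `ℚ(i) ≤ K` for `i = ζ^(2^k)`; `#Gal(L/ℚ(i)) = 2^k` and `σ₅ : ζ ↦ ζ⁵` (`fromZetaAut`) lies in it with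
order `2^k` (`ZMod.orderOf_five`), so `Gal(L/ℚ(i)) = ⟨σ₅⟩` is cyclic; `Gal(L/K) ≤ Gal(L/ℚ(i))` has order `2^j` for some
`j ≤ k`, as has `Gal(L/ℚ(ζ^(2^j)))`; subgroups of equal order of a finite cyclic group coincide; Galois correspondence.
[cite: Lemmermeyer1995, §2 proof of Proposition 1 h), case $p = 2$ (« If $\sqrt{-1} \in K_1$, then we must have
$K_1 = \Q(\zeta_m)$ for $m=2^\alpha$ and some $\alpha \ge 2$
(complex subfields of the field of $2^\mu$th roots of unity
containing $\sqrt{-1}$ necessarily have this form) »); proved here] -/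
theorem eq_adjoin_zeta_pow_of_sq_eq_neg_one {k : ℕ} [IsCyclotomicExtension {2 ^ (k + 2)} ℚ L]
    (K : IntermediateField ℚ L) (hK : ∃ x ∈ K, x ^ 2 = -1) :
    ∃ j, j ≤ k ∧ K = ℚ⟮(IsCyclotomicExtension.zeta (2 ^ (k + 2)) ℚ L) ^ 2 ^ j⟯ := by
  classical
  haveI hne : NeZero (2 ^ (k + 2)) := ⟨by positivity⟩
  set ζ := IsCyclotomicExtension.zeta (2 ^ (k + 2)) ℚ L with hζdef
  have hζ : IsPrimitiveRoot ζ (2 ^ (k + 2)) := IsCyclotomicExtension.zeta_spec _ ℚ L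
  haveI := IsCyclotomicExtension.isGalois {2 ^ (k + 2)} ℚ L
  have hpos : 0 < 2 ^ (k + 2) := NeZero.pos _
  have hirr : Irreducible (cyclotomic (2 ^ (k + 2)) ℚ) := cyclotomic.irreducible_rat hpos
  have hfin : Module.finrank ℚ L = 2 ^ (k + 1) := by
    rw [IsCyclotomicExtension.finrank L hirr, Nat.totient_prime_pow Nat.prime_two (by omega)]
    simp
  -- `i = ζ ^ 2 ^ k` is a square root of `-1`, and it lies in `K`
  have hi : IsPrimitiveRoot (ζ ^ 2 ^ k) 4 := hζ.pow hpos (by ring)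
  have hisq : (ζ ^ 2 ^ k) ^ 2 = -1 := by
    have h2 : IsPrimitiveRoot (ζ ^ 2 ^ (k + 1)) 2 := hζ.pow hpos (by ring)
    rw [← pow_mul, ← pow_succ]
    exact h2.eq_neg_one_of_two_right
  have hiK : ζ ^ 2 ^ k ∈ K := by
    obtain ⟨x, hxK, hx⟩ := hK
    rw [← hisq, sq_eq_sq_iff_eq_or_eq_neg] at hx
    rcases hx with rfl | rfl
    · exact hxK
    · have := neg_mem hxK; rwa [neg_neg] at this
  -- `ℚ(i)` has degree `2`, so its group `H` has order `2 ^ k`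
  have hF : Module.finrank ℚ ℚ⟮ζ ^ 2 ^ k⟯ = 2 := by
    rw [IntermediateField.adjoin.finrank (Algebra.IsIntegral.isIntegral _),
      ← cyclotomic_eq_minpoly_rat hi (by norm_num), natDegree_cyclotomic]
    decide
  have hHcard : Nat.card (ℚ⟮ζ ^ 2 ^ k⟯).fixingSubgroup = 2 ^ k := by
    rw [IsGalois.card_fixingSubgroup_eq_finrank]
    have h := Module.finrank_mul_finrank ℚ ℚ⟮ζ ^ 2 ^ k⟯ L
    rw [hF, hfin, pow_succ'] at h
    omega
  -- `σ : ζ ↦ ζ ^ 5` has order `2 ^ k`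
  have h5 : (5 : ℕ).Coprime (2 ^ (k + 2)) := Nat.Coprime.pow_right _ (by norm_num)
  have hζ5 : IsPrimitiveRoot (ζ ^ 5) (2 ^ (k + 2)) := hζ.pow_of_coprime 5 h5
  obtain ⟨σ, hσ⟩ : ∃ σ : L ≃ₐ[ℚ] L, σ ζ = ζ ^ 5 :=
    ⟨IsCyclotomicExtension.fromZetaAut hζ5 hirr, IsCyclotomicExtension.fromZetaAut_spec hζ5 hirr⟩
  have hσpow : ∀ j : ℕ, (σ ^ j) ζ = ζ ^ 5 ^ j := by
    intro j
    induction j with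
    | zero => simp
    | succ j ih => rw [pow_succ', AlgEquiv.mul_apply, ih, map_pow, hσ, ← pow_mul, ← pow_succ']
  have hT : ∀ j : ℕ, σ ^ j = 1 ↔ 2 ^ (k + 2) ∣ 5 ^ j - 1 := by
    intro j
    have h1 : 1 ≤ 5 ^ j := Nat.one_le_pow _ _ (by norm_num)
    rw [← hζ.pow_eq_one_iff_dvd]
    have e : ζ ^ (5 ^ j - 1) = 1 ↔ ζ ^ 5 ^ j = ζ := by
      conv_rhs => rw [← Nat.sub_add_cancel h1, pow_succ]
      constructor
      · intro h; rw [h, one_mul]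
      · intro h
        exact mul_right_cancel₀ (hζ.ne_zero (NeZero.ne _)) (h.trans (one_mul ζ).symm)
    rw [e]
    constructor
    · intro h
      have := hσpow j
      rwa [h, AlgEquiv.one_apply, eq_comm] at this
    · intro h
      apply AlgEquiv.coe_toAlgHom_injective
      apply (hζ.powerBasis ℚ).algHom_ext
      rw [IsPrimitiveRoot.powerBasis_gen]
      show (σ ^ j) ζ = (1 : L ≃ₐ[ℚ] L) ζ
      rw [hσpow, h, AlgEquiv.one_apply]
  have hT' : ∀ j : ℕ, (5 : ZMod (2 ^ (k + 2))) ^ j = 1 ↔ 2 ^ (k + 2) ∣ 5 ^ j - 1 := by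
    intro j
    have h1 : 1 ≤ 5 ^ j := Nat.one_le_pow _ _ (by norm_num)
    rw [← Nat.modEq_iff_dvd' h1]
    constructor
    · intro h
      have h' : ((5 ^ j : ℕ) : ZMod (2 ^ (k + 2))) = ((1 : ℕ) : ZMod (2 ^ (k + 2))) := by
        push_cast; exact h
      exact ((ZMod.natCast_eq_natCast_iff _ _ _).mp h').symm
    · intro h
      have h' := (ZMod.natCast_eq_natCast_iff _ _ _).mpr h.symm
      push_cast at h'
      exact h'
  have hord : orderOf σ = 2 ^ k := by
    rw [← ZMod.orderOf_five k, orderOf_eq_orderOf_iff]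
    intro j
    rw [hT, hT']
  -- `σ` fixes `i`, hence generates `H`, which is therefore cyclic
  have hσi : σ (ζ ^ 2 ^ k) = ζ ^ 2 ^ k := by
    rw [map_pow, hσ, ← pow_mul, show 5 * 2 ^ k = 2 ^ (k + 2) + 2 ^ k by ring, pow_add, hζ.pow_eq_one,
      one_mul]
  have hσH : σ ∈ (ℚ⟮ζ ^ 2 ^ k⟯).fixingSubgroup := by
    have hle : ℚ⟮ζ ^ 2 ^ k⟯ ≤ IntermediateField.fixedField (Subgroup.zpowers σ) := by
      rw [IntermediateField.adjoin_simple_le_iff, IntermediateField.mem_fixedField_iff]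
      intro f hf
      have hstab : σ ∈ MulAction.stabilizer (L ≃ₐ[ℚ] L) (ζ ^ 2 ^ k) := by
        rw [MulAction.mem_stabilizer_iff]; exact hσi
      exact (MulAction.mem_stabilizer_iff).mp (Subgroup.zpowers_le.mpr hstab hf)
    rw [IntermediateField.mem_fixingSubgroup_iff]
    intro x hx
    have hx' := hle hx
    rw [IntermediateField.mem_fixedField_iff] at hx'
    exact hx' σ (Subgroup.mem_zpowers σ)
  have hHeq : Subgroup.zpowers σ = (ℚ⟮ζ ^ 2 ^ k⟯).fixingSubgroup := by
    apply Subgroup.eq_of_le_of_card_ge (Subgroup.zpowers_le.mpr hσH)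
    rw [hHcard, Nat.card_zpowers, hord]
  haveI hcyc : IsCyclic (ℚ⟮ζ ^ 2 ^ k⟯).fixingSubgroup := by rw [← hHeq]; infer_instance
  -- the group of `K` sits in `H` and has order `2 ^ j`
  have hFK : ℚ⟮ζ ^ 2 ^ k⟯ ≤ K := IntermediateField.adjoin_simple_le_iff.mpr hiK
  have hSH : K.fixingSubgroup ≤ (ℚ⟮ζ ^ 2 ^ k⟯).fixingSubgroup := IntermediateField.fixingSubgroup_le hFK
  obtain ⟨j, hj, hSj⟩ := (Nat.dvd_prime_pow Nat.prime_two).1 (hHcard ▸ Subgroup.card_dvd_of_le hSH)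
  refine ⟨j, hj, ?_⟩
  -- so does the group of `ℚ(ζ ^ 2 ^ j)`
  have hr : IsPrimitiveRoot (ζ ^ 2 ^ j) (2 ^ (k + 2 - j)) :=
    hζ.pow hpos (by rw [← pow_add]; congr 1; omega)
  have hCcard : Nat.card (ℚ⟮ζ ^ 2 ^ j⟯).fixingSubgroup = 2 ^ j := by
    rw [IsGalois.card_fixingSubgroup_eq_finrank]
    have hdeg : Module.finrank ℚ ℚ⟮ζ ^ 2 ^ j⟯ = 2 ^ (k + 1 - j) := by
      rw [IntermediateField.adjoin.finrank (Algebra.IsIntegral.isIntegral _),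
        ← cyclotomic_eq_minpoly_rat hr (by positivity), natDegree_cyclotomic,
        Nat.totient_prime_pow Nat.prime_two (by omega)]
      simp only [Nat.add_one_sub_one, mul_one]
      congr 1; omega
    have h := Module.finrank_mul_finrank ℚ ℚ⟮ζ ^ 2 ^ j⟯ L
    rw [hdeg, hfin, show 2 ^ (k + 1) = 2 ^ (k + 1 - j) * 2 ^ j by rw [← pow_add]; congr 1; omega] at h
    exact Nat.eq_of_mul_eq_mul_left (by positivity) h
  have hCH : (ℚ⟮ζ ^ 2 ^ j⟯).fixingSubgroup ≤ (ℚ⟮ζ ^ 2 ^ k⟯).fixingSubgroup := by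
    apply IntermediateField.fixingSubgroup_le
    rw [IntermediateField.adjoin_simple_le_iff]
    have e : ζ ^ 2 ^ k = (ζ ^ 2 ^ j) ^ 2 ^ (k - j) := by
      rw [← pow_mul, ← pow_add, Nat.add_sub_cancel' hj]
    rw [e]
    exact pow_mem (IntermediateField.mem_adjoin_simple_self ℚ _) _
  have hSC : K.fixingSubgroup = (ℚ⟮ζ ^ 2 ^ j⟯).fixingSubgroup :=
    subgroup_eq_of_card_eq_tct hSH hCH (by rw [hSj, hCcard])
  calc K = IntermediateField.fixedField K.fixingSubgroup := (IsGalois.fixedField_fixingSubgroup K).symm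
    _ = IntermediateField.fixedField (ℚ⟮ζ ^ 2 ^ j⟯).fixingSubgroup := by rw [hSC]
    _ = ℚ⟮ζ ^ 2 ^ j⟯ := IsGalois.fixedField_fixingSubgroup _

/-- (10α) (10a) as a cyclotomic structure, `k`-form: `K` is `{2^α}`-cyclotomic over `ℚ` for some `2 ≤ α ≤ k + 2`
(`IsPrimitiveRoot.intermediateField_adjoin_isCyclotomicExtension`). [folklore] (proved here; private helper) -/
private theorem exists_isCyclotomicExtension_two_pow_tct {k : ℕ}
    [IsCyclotomicExtension {2 ^ (k + 2)} ℚ L] (K : IntermediateField ℚ L) (hK : ∃ x ∈ K, x ^ 2 = -1) :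
    ∃ α : ℕ, 2 ≤ α ∧ α ≤ k + 2 ∧ IsCyclotomicExtension {2 ^ α} ℚ K := by
  obtain ⟨j, hj, hKj⟩ := eq_adjoin_zeta_pow_of_sq_eq_neg_one (k := k) K hK
  haveI : NeZero (2 ^ (k + 2)) := ⟨by positivity⟩
  have hζ := IsCyclotomicExtension.zeta_spec (2 ^ (k + 2)) ℚ L
  have hr : IsPrimitiveRoot ((IsCyclotomicExtension.zeta (2 ^ (k + 2)) ℚ L) ^ 2 ^ j) (2 ^ (k + 2 - j)) :=
    hζ.pow (NeZero.pos _) (by rw [← pow_add]; congr 1; omega)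
  haveI : NeZero (2 ^ (k + 2 - j)) := ⟨by positivity⟩
  refine ⟨k + 2 - j, by omega, by omega, ?_⟩
  subst hKj
  exact hr.intermediateField_adjoin_isCyclotomicExtension ℚ

/-- **(10b) « have this form »: A SUBFIELD OF `ℚ(ζ_{2^μ})` CONTAINING `√-1` IS `{2^α}`-CYCLOTOMIC OVER `ℚ`, `2 ≤ α ≤ μ`**
(`μ ≥ 2`, `L` `{2^μ}`-cyclotomic over `ℚ`, `K : IntermediateField ℚ L` with some `x ∈ K`, `x² = -1`; by (10a) with
`α = μ - j`, `IsPrimitiveRoot.intermediateField_adjoin_isCyclotomicExtension`).  The form in which item (11) consumes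
the remark ((11h)–(11j)).
[cite: Lemmermeyer1995, §2 proof of Proposition 1 h), case $p = 2$ (« If $\sqrt{-1} \in K_1$, then we must have
$K_1 = \Q(\zeta_m)$ for $m=2^\alpha$ and some $\alpha \ge 2$
(complex subfields of the field of $2^\mu$th roots of unity
containing $\sqrt{-1}$ necessarily have this form) »); proved here] -/
theorem exists_isCyclotomicExtension_two_pow_of_sq_eq_neg_one {μ : ℕ} (hμ : 2 ≤ μ)
    [IsCyclotomicExtension {2 ^ μ} ℚ L] (K : IntermediateField ℚ L) (hK : ∃ x ∈ K, x ^ 2 = -1) :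
    ∃ α : ℕ, 2 ≤ α ∧ α ≤ μ ∧ IsCyclotomicExtension {2 ^ α} ℚ K := by
  obtain ⟨k, rfl⟩ : ∃ k, μ = k + 2 := ⟨μ - 2, by omega⟩
  exact exists_isCyclotomicExtension_two_pow_tct (k := k) K hK

/-- **(10c) « let $\widetilde{K}_1 = K_1(i)$; then $\widetilde{K}_1 = \Q(\zeta_m)$ for $m=2^\alpha$ »** (`μ ≥ 2`, `L`
`{2^μ}`-cyclotomic over `ℚ`, ANY `K : IntermediateField ℚ L`, `i ∈ L` with `i² = -1`): `K(i) = K ⊔ ℚ(i)` is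
`{2^α}`-cyclotomic over `ℚ` for some `2 ≤ α ≤ μ` ((10b)).  This is the first step of Lemmermeyer's second sub-case
`√-1 ∉ K₁`; its remaining steps are not typed ((D80)).
[cite: Lemmermeyer1995, §2 proof of Proposition 1 h), case $p = 2$ (« If $\sqrt{-1} \not\in K_1$, let $\widetilde{K}_1 = K_1(i)$;
then $\widetilde{K}_1 = \Q(\zeta_m)$ for $m=2^\alpha$ and some
$\alpha \ge 2$ »); proved here] -/
theorem exists_isCyclotomicExtension_two_pow_sup_adjoin {μ : ℕ} (hμ : 2 ≤ μ)
    [IsCyclotomicExtension {2 ^ μ} ℚ L] (K : IntermediateField ℚ L) {i : L} (hi : i ^ 2 = -1) :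
    ∃ α : ℕ, 2 ≤ α ∧ α ≤ μ ∧ IsCyclotomicExtension {2 ^ α} ℚ ↥(K ⊔ ℚ⟮i⟯) :=
  exists_isCyclotomicExtension_two_pow_of_sq_eq_neg_one hμ _
    ⟨i, (le_sup_right : ℚ⟮i⟯ ≤ K ⊔ ℚ⟮i⟯) (IntermediateField.mem_adjoin_simple_self ℚ i), hi⟩

end TwoPowerSubfields

section CompositaAnyAmbient

/-! ### (11) Proposition 1 h) for composita `K₁K₂` in an arbitrary ambient number field: the odd case and the sub-case `√-1 ∈ K₁` -/

/-- (11α) = M113 (9α), copied (private there). [folklore] (proved here; private helper) -/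
private theorem fixes_of_odd_finrank_tct {F L M : Type} [Field F] [Field L] [Field M] [NumberField F] [NumberField L]
    [NumberField M] [Algebra F L] [Algebra L M] [Algebra F M] [IsScalarTower F L M] [Normal ℚ L] [IsGalois F L]
    (hodd : Odd (Module.finrank F L)) (σ : M ≃ₐ[ℚ] M) (hσ : σ ^ 2 = 1)
    (hfix : ∀ x : F, σ (algebraMap F M x) = algebraMap F M x) (y : L) :
    σ (algebraMap L M y) = algebraMap L M y := by
  have hτF : ∀ x : F, σ.restrictNormal L (algebraMap F L x) = algebraMap F L x := by
    intro x
    apply (algebraMap L M).injective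
    rw [AlgEquiv.restrictNormal_commutes, ← IsScalarTower.algebraMap_apply, hfix]
  let τ : L ≃ₐ[F] L := { (σ.restrictNormal L : L ≃+* L) with commutes' := hτF }
  have hτ : ∀ z : L, τ z = σ.restrictNormal L z := fun _ => rfl
  have hτ2 : τ ^ 2 = 1 := by
    apply AlgEquiv.ext
    intro z
    apply (algebraMap L M).injective
    rw [sq, AlgEquiv.mul_apply, AlgEquiv.one_apply, hτ, hτ, AlgEquiv.restrictNormal_commutes,
      AlgEquiv.restrictNormal_commutes]
    have := AlgEquiv.congr_fun hσ (algebraMap L M z)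
    rwa [sq, AlgEquiv.mul_apply, AlgEquiv.one_apply] at this
  have h1 : orderOf τ ∣ 2 := orderOf_dvd_of_pow_eq_one hτ2
  have h2 : orderOf τ ∣ Module.finrank F L := by
    rw [← IsGalois.card_aut_eq_finrank]
    exact orderOf_dvd_natCard τ
  have hτ1 : τ = 1 := by
    rcases (Nat.dvd_prime Nat.prime_two).mp h1 with h | h
    · exact orderOf_eq_one_iff.mp h
    · exfalso
      rw [h] at h2
      exact (Nat.not_even_iff_odd.mpr hodd) (even_iff_two_dvd.mpr h2)
  have hy : σ.restrictNormal L y = y := by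
    rw [← hτ, hτ1, AlgEquiv.one_apply]
  rw [← AlgEquiv.restrictNormal_commutes, hy]

variable {M : Type} [Field M] [NumberField M]

/-- (11β) an automorphism of `A ⊔ B` fixing `A` and `B` pointwise is the identity. [folklore] (proved here; private
helper) -/
private theorem algEquiv_sup_eq_one_tct (A B : IntermediateField ℚ M) (σ : ↥(A ⊔ B) ≃ₐ[ℚ] ↥(A ⊔ B))
    (hA : ∀ y : ↥(A ⊔ B), (y : M) ∈ A → σ y = y) (hB : ∀ y : ↥(A ⊔ B), (y : M) ∈ B → σ y = y) : σ = 1 := by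
  set Fix : IntermediateField ℚ ↥(A ⊔ B) := IntermediateField.fixedField (Subgroup.zpowers σ) with hFixdef
  have hmem : ∀ y : ↥(A ⊔ B), σ y = y → y ∈ Fix := by
    intro y hy
    rw [IntermediateField.mem_fixedField_iff]
    intro f hf
    have hst : σ ∈ MulAction.stabilizer (↥(A ⊔ B) ≃ₐ[ℚ] ↥(A ⊔ B)) y := by
      rw [MulAction.mem_stabilizer_iff]; exact hy
    exact (MulAction.mem_stabilizer_iff).mp (Subgroup.zpowers_le.mpr hst hf)
  have hlift : IntermediateField.lift Fix = A ⊔ B := by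
    apply le_antisymm (IntermediateField.lift_le Fix)
    apply sup_le
    · intro a ha
      exact (IntermediateField.mem_lift (⟨a, (le_sup_left : A ≤ A ⊔ B) ha⟩ : ↥(A ⊔ B))).mpr (hmem _ (hA _ ha))
    · intro b hb
      exact (IntermediateField.mem_lift (⟨b, (le_sup_right : B ≤ A ⊔ B) hb⟩ : ↥(A ⊔ B))).mpr (hmem _ (hB _ hb))
  have hFix : ∀ y : ↥(A ⊔ B), y ∈ Fix := fun y =>
    (IntermediateField.mem_lift y).mp (by rw [hlift]; exact y.2)
  apply AlgEquiv.ext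
  intro y
  have hy := hFix y
  rw [IntermediateField.mem_fixedField_iff] at hy
  exact hy σ (Subgroup.mem_zpowers σ)

/-- (11γ) THE ENGINE, relative form.  `E ≤ A ⊔ B` intermediate fields of a number field `M` with `(A ⊔ B)/ℚ` Galois; if
every `ℚ`-involution of `A ⊔ B` fixing `E` pointwise fixes `A` and `B` pointwise, then `(A ⊔ B : E)` is odd.
[folklore] (proved here; private helper) -/
private theorem odd_finrank_sup_tct (A B E : IntermediateField ℚ M) (hE : E ≤ A ⊔ B) [IsGalois ℚ ↥(A ⊔ B)]
    (hfix : ∀ σ : ↥(A ⊔ B) ≃ₐ[ℚ] ↥(A ⊔ B), σ ^ 2 = 1 → (∀ y : ↥(A ⊔ B), (y : M) ∈ E → σ y = y) →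
      (∀ y : ↥(A ⊔ B), (y : M) ∈ A → σ y = y) ∧ (∀ y : ↥(A ⊔ B), (y : M) ∈ B → σ y = y)) :
    letI : Algebra ↥E ↥(A ⊔ B) := (IntermediateField.inclusion hE).toRingHom.toAlgebra
    Odd (Module.finrank ↥E ↥(A ⊔ B)) := by
  letI : Algebra ↥E ↥(A ⊔ B) := (IntermediateField.inclusion hE).toRingHom.toAlgebra
  haveI : IsScalarTower ℚ ↥E ↥(A ⊔ B) := IsScalarTower.of_algebraMap_eq (fun _ => rfl)
  haveI : IsGalois ↥E ↥(A ⊔ B) := IsGalois.tower_top_of_isGalois ℚ ↥E ↥(A ⊔ B)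
  by_contra hev
  rw [Nat.not_odd_iff_even] at hev
  obtain ⟨σ, hσ⟩ := exists_prime_orderOf_dvd_card' 2 (G := ↥(A ⊔ B) ≃ₐ[↥E] ↥(A ⊔ B))
    (by rw [IsGalois.card_aut_eq_finrank]; exact even_iff_two_dvd.mp hev)
  have hσ2 : σ.restrictScalars ℚ ^ 2 = 1 := by
    apply AlgEquiv.ext
    intro x
    have h := AlgEquiv.congr_fun (pow_orderOf_eq_one σ) x
    rw [hσ, sq, AlgEquiv.mul_apply, AlgEquiv.one_apply] at h
    rw [sq, AlgEquiv.mul_apply, AlgEquiv.one_apply]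
    exact h
  have hfixE : ∀ y : ↥(A ⊔ B), (y : M) ∈ E → σ.restrictScalars ℚ y = y := by
    intro y hy
    have h := σ.commutes ⟨y, hy⟩
    have e : algebraMap ↥E ↥(A ⊔ B) ⟨(y : M), hy⟩ = y := Subtype.ext rfl
    rw [e] at h
    exact h
  obtain ⟨hA, hB⟩ := hfix _ hσ2 hfixE
  have hσ1 : σ.restrictScalars ℚ = 1 := algEquiv_sup_eq_one_tct A B _ hA hB
  have hσ1' : σ = 1 := by
    apply AlgEquiv.ext
    intro x
    have h := AlgEquiv.congr_fun hσ1 x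
    rwa [AlgEquiv.restrictScalars_apply, AlgEquiv.one_apply] at h
  rw [hσ1', orderOf_one] at hσ
  exact absurd hσ (by norm_num)

/-- (11δ) for `K₂ ≤ B ≤ N` with `B` `{p^k}`-cyclotomic, `p` odd, `K₂` totally complex: a `ℚ`-involution of `N` fixing
`K₂` fixes `B` ((11α) with the odd index `(B : K₂)` of M113 item (7b)). [folklore] (proved here; private helper) -/
private theorem involution_fixes_tct {p k : ℕ} (hp : p.Prime) (hp2 : p ≠ 2) (hk : 0 < k)
    (N B K₂ : IntermediateField ℚ M) [IsCyclotomicExtension {p ^ k} ℚ B] (hBN : B ≤ N) (hKB : K₂ ≤ B)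
    [IsTotallyComplex K₂] (σ : N ≃ₐ[ℚ] N) (hσ : σ ^ 2 = 1) (hfix : ∀ y : N, (y : M) ∈ K₂ → σ y = y)
    (y : N) (hy : (y : M) ∈ B) : σ y = y := by
  haveI : NeZero (p ^ k) := ⟨pow_ne_zero _ hp.ne_zero⟩
  haveI : IsGalois ℚ B := IsCyclotomicExtension.isGalois {p ^ k} ℚ B
  letI : Algebra K₂ B := (IntermediateField.inclusion hKB).toRingHom.toAlgebra
  letI : Algebra B N := (IntermediateField.inclusion hBN).toRingHom.toAlgebra
  letI : Algebra K₂ N := (IntermediateField.inclusion (hKB.trans hBN)).toRingHom.toAlgebra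
  haveI : IsScalarTower K₂ B N := IsScalarTower.of_algebraMap_eq (fun _ => rfl)
  haveI : IsGalois K₂ B := IsGalois.tower_top_of_isGalois ℚ K₂ B
  have hodd : Odd (Module.finrank K₂ B) :=
    odd_finrank_of_isTotallyComplex_of_algebra_oddPrimePow_cyclotomic (K := K₂) (M := B) hp hp2 hk
  have hfix' : ∀ x : K₂, σ (algebraMap K₂ N x) = algebraMap K₂ N x := fun x => hfix _ x.2
  exact fixes_of_odd_finrank_tct hodd σ hσ hfix' ⟨y, hy⟩

/-- (11ε) = M113 (9ε). [folklore] (proved here; private helper) -/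
private theorem primePow_mul_primePow_tct {p q μ ν : ℕ} (hp : p.Prime) (hq : q.Prime) (hpq : p ≠ q) (hμ : 0 < μ)
    (hν : 0 < ν) : 2 < p ^ μ * q ^ ν ∧ ¬ IsPrimePow (p ^ μ * q ^ ν) := by
  refine ⟨?_, ?_⟩
  · have h1 : 2 ≤ p ^ μ := le_trans hp.two_le (Nat.le_self_pow hμ.ne' p)
    have h2 : 2 ≤ q ^ ν := le_trans hq.two_le (Nat.le_self_pow hν.ne' q)
    nlinarith
  · rintro ⟨r, k, hr, hk, hrk⟩
    have hr' : r.Prime := Prime.nat_prime hr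
    have hpr : p ∣ r ^ k := by rw [hrk]; exact (dvd_pow_self p hμ.ne').mul_right _
    have hqr : q ∣ r ^ k := by rw [hrk]; exact (dvd_pow_self q hν.ne').mul_left _
    have h1 : p = r := (Nat.prime_dvd_prime_iff_eq hp hr').mp (hp.dvd_of_dvd_pow hpr)
    have h2 : q = r := (Nat.prime_dvd_prime_iff_eq hq hr').mp (hq.dvd_of_dvd_pow hqr)
    exact hpq (h1.trans h2.symm)

/-- **(11a) `ℚ(ζ_m)ℚ(ζ_n) = ℚ(ζ_{mn})`, « $K_1(\zeta_n) = \Q(\zeta_{mn})$ »** (coprime `m, n > 1`; `M` ANY number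
field; `A, B : IntermediateField ℚ M` `{m}`- resp. `{n}`-cyclotomic over `ℚ`): the compositum `A ⊔ B` is
`{m n}`-cyclotomic over `ℚ` ((D79)).  Proof: with `a ∈ A`, `b ∈ B` primitive `m`-th, `n`-th roots of unity
(`IsCyclotomicExtension.zeta`), `ab` has order `mn` (`Commute.orderOf_mul_eq_mul_orderOf_of_coprime`);
`a = ((ab)^n)^t` for `nt ≡ 1 (mod m)` and symmetrically, so `a, b ∈ ℚ(ab)`; `A = ℚ(a)`, `B = ℚ(b)` by the degree `φ`;
hence `A ⊔ B = ℚ(ab)` (`IsPrimitiveRoot.intermediateField_adjoin_isCyclotomicExtension`, `IsCyclotomicExtension.equiv`).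
M113 (9β) is the special case `M = ℚ(ζ_{mn})`, `Lm ⊔ Ln = ⊤`.
[cite: Lemmermeyer1995, §2 proof of Proposition 1 h), case $p = 2$ (« By f) it suffices to show that
$K_1(\zeta_n) = \Q(\zeta_{mn})$ has unit index $2$, and this
follows from g). »); proved here] -/
theorem isCyclotomicExtension_sup_of_coprime {m n : ℕ} (hm : 1 < m) (hn : 1 < n) (hmn : m.Coprime n)
    (A B : IntermediateField ℚ M) [IsCyclotomicExtension {m} ℚ A] [IsCyclotomicExtension {n} ℚ B] :
    IsCyclotomicExtension {m * n} ℚ ↥(A ⊔ B) := by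
  haveI : NeZero m := ⟨by omega⟩
  haveI : NeZero n := ⟨by omega⟩
  haveI : NeZero (m * n) := ⟨mul_ne_zero (NeZero.ne m) (NeZero.ne n)⟩
  set a : M := ((IsCyclotomicExtension.zeta m ℚ A : A) : M) with ha_def
  set b : M := ((IsCyclotomicExtension.zeta n ℚ B : B) : M) with hb_def
  have ha : IsPrimitiveRoot a m :=
    IsPrimitiveRoot.coe_submonoidClass_iff.mpr (IsCyclotomicExtension.zeta_spec m ℚ A)
  have hb : IsPrimitiveRoot b n :=
    IsPrimitiveRoot.coe_submonoidClass_iff.mpr (IsCyclotomicExtension.zeta_spec n ℚ B)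
  have haA : a ∈ A := (IsCyclotomicExtension.zeta m ℚ A).2
  have hbB : b ∈ B := (IsCyclotomicExtension.zeta n ℚ B).2
  have hr : IsPrimitiveRoot (a * b) (m * n) := by
    have h := (Commute.all a b).orderOf_mul_eq_mul_orderOf_of_coprime
      (by rw [← ha.eq_orderOf, ← hb.eq_orderOf]; exact hmn)
    rw [← ha.eq_orderOf, ← hb.eq_orderOf] at h
    rw [← h]
    exact IsPrimitiveRoot.orderOf (a * b)
  have hpow : ∀ {x : M} {k l : ℕ}, IsPrimitiveRoot x k → 1 < k → k.Coprime l →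
      x ^ l ∈ ℚ⟮a * b⟯ → x ∈ ℚ⟮a * b⟯ := by
    intro x k l hx hk hkl hxl
    obtain ⟨t, -, ht⟩ := Nat.exists_mul_mod_eq_one_of_coprime hkl.symm hk
    have e : x = (x ^ l) ^ t := by
      rw [← pow_mul, ← pow_mod_orderOf, ← hx.eq_orderOf, ht, pow_one]
    rw [e]
    exact pow_mem hxl _
  have haQ : a ∈ ℚ⟮a * b⟯ := by
    refine hpow ha hm hmn ?_
    rw [show a ^ n = (a * b) ^ n by rw [mul_pow, hb.pow_eq_one, mul_one]]
    exact pow_mem (IntermediateField.mem_adjoin_simple_self ℚ _) _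
  have hbQ : b ∈ ℚ⟮a * b⟯ := by
    refine hpow hb hn hmn.symm ?_
    rw [show b ^ m = (a * b) ^ m by rw [mul_pow, ha.pow_eq_one, one_mul]]
    exact pow_mem (IntermediateField.mem_adjoin_simple_self ℚ _) _
  have hgen : ∀ {k : ℕ} [NeZero k] (C : IntermediateField ℚ M) [IsCyclotomicExtension {k} ℚ C],
      ((IsCyclotomicExtension.zeta k ℚ C : C) : M) ∈ ℚ⟮a * b⟯ → C ≤ ℚ⟮a * b⟯ := by
    intro k _ C _ hz
    have hζ : IsPrimitiveRoot ((IsCyclotomicExtension.zeta k ℚ C : C) : M) k :=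
      IsPrimitiveRoot.coe_submonoidClass_iff.mpr (IsCyclotomicExtension.zeta_spec k ℚ C)
    have hC : ℚ⟮((IsCyclotomicExtension.zeta k ℚ C : C) : M)⟯ = C := by
      apply IntermediateField.eq_of_le_of_finrank_eq
      · exact IntermediateField.adjoin_simple_le_iff.mpr (IsCyclotomicExtension.zeta k ℚ C).2
      · rw [IntermediateField.adjoin.finrank (Algebra.IsIntegral.isIntegral _),
          ← Polynomial.cyclotomic_eq_minpoly_rat hζ (NeZero.pos k), Polynomial.natDegree_cyclotomic,
          IsCyclotomicExtension.finrank (n := k) ↥C (Polynomial.cyclotomic.irreducible_rat (NeZero.pos k))]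
    rw [← hC]
    exact IntermediateField.adjoin_simple_le_iff.mpr hz
  have heq : ℚ⟮a * b⟯ = A ⊔ B :=
    le_antisymm (IntermediateField.adjoin_simple_le_iff.mpr
      (mul_mem ((le_sup_left : A ≤ A ⊔ B) haA) ((le_sup_right : B ≤ A ⊔ B) hbB)))
      (sup_le (hgen A haQ) (hgen B hbQ))
  exact IsCyclotomicExtension.equiv {m * n} ℚ (↥ℚ⟮a * b⟯) (h := hr.intermediateField_adjoin_isCyclotomicExtension ℚ)
    (IntermediateField.equivOfEq heq)

/-- (11ζ) « so is $(\Q(\zeta_{mn}):K_1K_2)$ » in an arbitrary ambient field: `(Lm ⊔ Ln : K₁ ⊔ K₂)` is odd (`p, q`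
odd; engine (11γ) with (11δ) on both sides). [folklore] (proved here; private helper) -/
private theorem odd_finrank_sup_sup_tct {p q μ ν : ℕ} (hp : p.Prime) (hq : q.Prime) (hp2 : p ≠ 2) (hq2 : q ≠ 2)
    (hpq : p ≠ q) (hμ : 0 < μ) (hν : 0 < ν) (Lm Ln K₁ K₂ : IntermediateField ℚ M)
    [IsCyclotomicExtension {p ^ μ} ℚ Lm] [IsCyclotomicExtension {q ^ ν} ℚ Ln] (h₁ : K₁ ≤ Lm) (h₂ : K₂ ≤ Ln)
    [IsTotallyComplex K₁] [IsTotallyComplex K₂] :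
    letI : Algebra ↥(K₁ ⊔ K₂) ↥(Lm ⊔ Ln) := (IntermediateField.inclusion (sup_le_sup h₁ h₂)).toRingHom.toAlgebra
    Odd (Module.finrank ↥(K₁ ⊔ K₂) ↥(Lm ⊔ Ln)) := by
  have hm : 1 < p ^ μ := lt_of_lt_of_le hp.one_lt (Nat.le_self_pow hμ.ne' p)
  have hn : 1 < q ^ ν := lt_of_lt_of_le hq.one_lt (Nat.le_self_pow hν.ne' q)
  haveI := isCyclotomicExtension_sup_of_coprime (M := M) hm hn (Nat.coprime_pow_primes μ ν hp hq hpq) Lm Ln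
  haveI : NeZero (p ^ μ * q ^ ν) := ⟨mul_ne_zero (pow_ne_zero _ hp.ne_zero) (pow_ne_zero _ hq.ne_zero)⟩
  haveI : IsGalois ℚ ↥(Lm ⊔ Ln) := IsCyclotomicExtension.isGalois {p ^ μ * q ^ ν} ℚ ↥(Lm ⊔ Ln)
  exact odd_finrank_sup_tct Lm Ln (K₁ ⊔ K₂) (sup_le_sup h₁ h₂) (fun σ hσ hfix =>
    ⟨fun y hy => involution_fixes_tct hp hp2 hμ (Lm ⊔ Ln) Lm K₁ le_sup_left h₁ σ hσ
        (fun z hz => hfix z ((le_sup_left : K₁ ≤ K₁ ⊔ K₂) hz)) y hy,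
     fun y hy => involution_fixes_tct hq hq2 hν (Lm ⊔ Ln) Ln K₂ le_sup_right h₂ σ hσ
        (fun z hz => hfix z ((le_sup_right : K₂ ≤ K₁ ⊔ K₂) hz)) y hy⟩)

/-- (11η) `(K₁ ⊔ Ln : K₁ ⊔ K₂)` is odd for `K₁` `{2^α}`-cyclotomic (engine (11γ): `K₁` is fixed trivially, `Ln` by
(11δ)). [folklore] (proved here; private helper) -/
private theorem odd_finrank_sup_sup_two_tct {α q ν : ℕ} (hα : 2 ≤ α) (hq : q.Prime) (hq2 : q ≠ 2) (hν : 0 < ν)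
    (K₁ Ln K₂ : IntermediateField ℚ M) [IsCyclotomicExtension {2 ^ α} ℚ K₁] [IsCyclotomicExtension {q ^ ν} ℚ Ln]
    (h₂ : K₂ ≤ Ln) [IsTotallyComplex K₂] :
    letI : Algebra ↥(K₁ ⊔ K₂) ↥(K₁ ⊔ Ln) := (IntermediateField.inclusion (sup_le_sup_left h₂ K₁)).toRingHom.toAlgebra
    Odd (Module.finrank ↥(K₁ ⊔ K₂) ↥(K₁ ⊔ Ln)) := by
  have hm : 1 < 2 ^ α := Nat.one_lt_two_pow (by omega)
  have hn : 1 < q ^ ν := lt_of_lt_of_le hq.one_lt (Nat.le_self_pow hν.ne' q)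
  haveI := isCyclotomicExtension_sup_of_coprime (M := M) hm hn
    (Nat.coprime_pow_primes α ν Nat.prime_two hq (Ne.symm hq2)) K₁ Ln
  haveI : NeZero (2 ^ α * q ^ ν) := ⟨mul_ne_zero (pow_ne_zero _ two_ne_zero) (pow_ne_zero _ hq.ne_zero)⟩
  haveI : IsGalois ℚ ↥(K₁ ⊔ Ln) := IsCyclotomicExtension.isGalois {2 ^ α * q ^ ν} ℚ ↥(K₁ ⊔ Ln)
  exact odd_finrank_sup_tct K₁ Ln (K₁ ⊔ K₂) (sup_le_sup_left h₂ K₁) (fun σ hσ hfix =>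
    ⟨fun y hy => hfix y ((le_sup_left : K₁ ≤ K₁ ⊔ K₂) hy),
     fun y hy => involution_fixes_tct hq hq2 hν (K₁ ⊔ Ln) Ln K₂ le_sup_right h₂ σ hσ
        (fun z hz => hfix z ((le_sup_right : K₂ ≤ K₁ ⊔ K₂) hz)) y hy⟩)

/-- **(11b) PROPOSITION 1 h), ODD CASE, ARBITRARY AMBIENT FIELD: THE COMPOSITUM `K₁K₂` IS CM** (`p ≠ q` ODD primes,
`μ, ν > 0`; `M` ANY number field; `Lm, Ln : IntermediateField ℚ M` `{p^μ}`- resp. `{q^ν}`-cyclotomic over `ℚ`;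
`K₁ ≤ Lm`, `K₂ ≤ Ln` totally complex — e.g. CM —; `K₁K₂ = K₁ ⊔ K₂`).  M113 item (9b) assumed `M = ℚ(ζ_{p^μ q^ν})`; here
`ℚ(ζ_{p^μ q^ν}) = Lm ⊔ Ln ≤ M` ((11a)), the index `(Lm ⊔ Ln : K₁ ⊔ K₂)` is odd (an involution of `Lm ⊔ Ln` over `K₁K₂`
fixes `Lm`, `Ln` by M113 item (7b), hence everything), and M113 item (7a) applies ((D79)).
[cite: Lemmermeyer1995, §2 Proposition 1 h) (« Let $K_1 \subseteq \Q(\zeta_m)$ and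
$K_2 \subseteq \Q(\zeta_n)$ be abelian CM-fields, where $m=p^\mu$
and $n=q^\nu$ are prime powers such that $p \ne q$, and let
$K = K_1K_2$ ») and its proof (« h) First assume that $m$ and $n$ are odd. »); proved here] -/
theorem isCMField_sup_of_cyclotomic' {p q μ ν : ℕ} (hp : p.Prime) (hq : q.Prime) (hp2 : p ≠ 2) (hq2 : q ≠ 2)
    (hpq : p ≠ q) (hμ : 0 < μ) (hν : 0 < ν) (Lm Ln K₁ K₂ : IntermediateField ℚ M)
    [IsCyclotomicExtension {p ^ μ} ℚ Lm] [IsCyclotomicExtension {q ^ ν} ℚ Ln] (h₁ : K₁ ≤ Lm) (h₂ : K₂ ≤ Ln)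
    [IsTotallyComplex K₁] [IsTotallyComplex K₂] : IsCMField ↥(K₁ ⊔ K₂) := by
  have hm : 1 < p ^ μ := lt_of_lt_of_le hp.one_lt (Nat.le_self_pow hμ.ne' p)
  have hn : 1 < q ^ ν := lt_of_lt_of_le hq.one_lt (Nat.le_self_pow hν.ne' q)
  haveI := isCyclotomicExtension_sup_of_coprime (M := M) hm hn (Nat.coprime_pow_primes μ ν hp hq hpq) Lm Ln
  letI : Algebra ↥(K₁ ⊔ K₂) ↥(Lm ⊔ Ln) := (IntermediateField.inclusion (sup_le_sup h₁ h₂)).toRingHom.toAlgebra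
  exact isCMField_of_odd_finrank_of_algebra_cyclotomic (K := ↥(K₁ ⊔ K₂)) (M := ↥(Lm ⊔ Ln))
    (primePow_mul_primePow_tct hp hq hpq hμ hν).1
    (odd_finrank_sup_sup_tct hp hq hp2 hq2 hpq hμ hν Lm Ln K₁ K₂ h₁ h₂)

/-- **(11c) PROPOSITION 1 h), ODD CASE, ARBITRARY AMBIENT FIELD: `Q(K₁K₂) = 2`** (setting of (11b); the CM structure of
`K₁ ⊔ K₂` is supplied in the statement by `haveI`).  As in the paper: `(ℚ(ζ_{mn}) : K₁K₂)` is odd — inside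
`Lm ⊔ Ln = ℚ(ζ_{mn})` ((11a), (D79)) —, `Q(ℚ(ζ_{mn})) = 2` since `mn` is not a prime power (Proposition 1 g), M113 item
(3c)), so `Q(K₁K₂) = 2` by Proposition 1 f) (M113 item (7f)).  M113 (9c) is the case `M = ℚ(ζ_{mn})`.
[cite: Lemmermeyer1995, §2 Proposition 1 h) (« h) (see Example 4 below) Let $K_1 \subseteq \Q(\zeta_m)$ and
$K_2 \subseteq \Q(\zeta_n)$ be abelian CM-fields, where $m=p^\mu$
and $n=q^\nu$ are prime powers such that $p \ne q$, and let
$K = K_1K_2$; then $Q(K) = 2$. ») and its proof, odd case (« Since $(\Q(\zeta_m):K_1)$ and $(\Q(\zeta_n):K_2)$ are both odd, so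
is $(\Q(\zeta_{mn}):K_1K_2)$; moreover, $\Q(\zeta_{mn})$ has unit
index $Q = 2$, hence the assertion follows from f) and g). »); proved here] -/
theorem indexRealUnits_sup_eq_two_of_cyclotomic' {p q μ ν : ℕ} (hp : p.Prime) (hq : q.Prime) (hp2 : p ≠ 2)
    (hq2 : q ≠ 2) (hpq : p ≠ q) (hμ : 0 < μ) (hν : 0 < ν) (Lm Ln K₁ K₂ : IntermediateField ℚ M)
    [IsCyclotomicExtension {p ^ μ} ℚ Lm] [IsCyclotomicExtension {q ^ ν} ℚ Ln] (h₁ : K₁ ≤ Lm) (h₂ : K₂ ≤ Ln)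
    [IsTotallyComplex K₁] [IsTotallyComplex K₂] :
    haveI : IsCMField ↥(K₁ ⊔ K₂) := isCMField_sup_of_cyclotomic' hp hq hp2 hq2 hpq hμ hν Lm Ln K₁ K₂ h₁ h₂
    IsCMField.indexRealUnits ↥(K₁ ⊔ K₂) = 2 := by
  have hm : 1 < p ^ μ := lt_of_lt_of_le hp.one_lt (Nat.le_self_pow hμ.ne' p)
  have hn : 1 < q ^ ν := lt_of_lt_of_le hq.one_lt (Nat.le_self_pow hν.ne' q)
  haveI := isCyclotomicExtension_sup_of_coprime (M := M) hm hn (Nat.coprime_pow_primes μ ν hp hq hpq) Lm Ln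
  letI : Algebra ↥(K₁ ⊔ K₂) ↥(Lm ⊔ Ln) := (IntermediateField.inclusion (sup_le_sup h₁ h₂)).toRingHom.toAlgebra
  obtain ⟨h2, hnp⟩ := primePow_mul_primePow_tct hp hq hpq hμ hν
  have h4 : ¬ (p ^ μ * q ^ ν) % 4 = 2 := by
    obtain ⟨k, hk⟩ : Odd (p ^ μ * q ^ ν) := ((hp.odd_of_ne_two hp2).pow).mul ((hq.odd_of_ne_two hq2).pow)
    omega
  exact indexRealUnits_eq_two_of_odd_finrank_cyclotomic (K := ↥(K₁ ⊔ K₂)) (M := ↥(Lm ⊔ Ln)) h2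
    (by rwa [if_neg h4]) (odd_finrank_sup_sup_tct hp hq hp2 hq2 hpq hμ hν Lm Ln K₁ K₂ h₁ h₂)

/-- **(11d) `κ_{K₁K₂/(K₁K₂)⁺} = 1`, ODD CASE, ARBITRARY AMBIENT FIELD** (setting of (11b); by the odd index inside
`Lm ⊔ Ln` and M113 item (7g) — `Q = 2` and Proposition 1 b)).
[cite: Lemmermeyer1995, §2 Proposition 1 h) (« and let
$K = K_1K_2$; then $Q(K) = 2$. ») with Proposition 1 b) (« b) (Satz 16, 17) if $Q(L) = 2$ then $\kappa_{L/L^+} = 1$; »); proved here] -/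
theorem ker_classGroupExtendedHom_maximalRealSubfield_sup_eq_bot_of_cyclotomic' {p q μ ν : ℕ} (hp : p.Prime)
    (hq : q.Prime) (hp2 : p ≠ 2) (hq2 : q ≠ 2) (hpq : p ≠ q) (hμ : 0 < μ) (hν : 0 < ν)
    (Lm Ln K₁ K₂ : IntermediateField ℚ M) [IsCyclotomicExtension {p ^ μ} ℚ Lm]
    [IsCyclotomicExtension {q ^ ν} ℚ Ln] (h₁ : K₁ ≤ Lm) (h₂ : K₂ ≤ Ln) [IsTotallyComplex K₁]
    [IsTotallyComplex K₂] :
    haveI : IsCMField ↥(K₁ ⊔ K₂) := isCMField_sup_of_cyclotomic' hp hq hp2 hq2 hpq hμ hν Lm Ln K₁ K₂ h₁ h₂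
    (ClassGroup.extendedHom (𝓞 (maximalRealSubfield ↥(K₁ ⊔ K₂))) (𝓞 ↥(K₁ ⊔ K₂))).ker = ⊥ := by
  have hm : 1 < p ^ μ := lt_of_lt_of_le hp.one_lt (Nat.le_self_pow hμ.ne' p)
  have hn : 1 < q ^ ν := lt_of_lt_of_le hq.one_lt (Nat.le_self_pow hν.ne' q)
  haveI := isCyclotomicExtension_sup_of_coprime (M := M) hm hn (Nat.coprime_pow_primes μ ν hp hq hpq) Lm Ln
  letI : Algebra ↥(K₁ ⊔ K₂) ↥(Lm ⊔ Ln) := (IntermediateField.inclusion (sup_le_sup h₁ h₂)).toRingHom.toAlgebra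
  exact ker_classGroupExtendedHom_maximalRealSubfield_eq_bot_of_odd_finrank_cyclotomic (K := ↥(K₁ ⊔ K₂))
    (M := ↥(Lm ⊔ Ln)) (primePow_mul_primePow_tct hp hq hpq hμ hν).1
    (odd_finrank_sup_sup_tct hp hq hp2 hq2 hpq hμ hν Lm Ln K₁ K₂ h₁ h₂)

/-- **(11e) THE CASE `p = 2`, `K₁` A COPY OF `ℚ(ζ_{2^α})` IN ANY AMBIENT FIELD: `K₁K₂` IS CM** (`α ≥ 2`, `q` an odd
prime, `ν > 0`; `M` ANY number field; `K₁, Ln : IntermediateField ℚ M` `{2^α}`- resp. `{q^ν}`-cyclotomic over `ℚ`;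
`K₂ ≤ Ln` totally complex).  `K₁(ζ_n) = K₁ ⊔ Ln` is `{2^α q^ν}`-cyclotomic ((11a)); an involution of it over `K₁ ⊔ K₂`
fixes `K₁` and, `(Ln : K₂)` being odd (M113 item (7b)), `Ln`; so `(K₁ ⊔ Ln : K₁ ⊔ K₂)` is odd and M113 item (7a)
applies.  M113 (9f) is the case `M = ℚ(ζ_{2^α q^ν})`, `K₁ = Lm`.
[cite: Lemmermeyer1995, §2 Proposition 1 h) (« Let $K_1 \subseteq \Q(\zeta_m)$ and
$K_2 \subseteq \Q(\zeta_n)$ be abelian CM-fields, where $m=p^\mu$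
and $n=q^\nu$ are prime powers such that $p \ne q$, and let
$K = K_1K_2$ ») and its proof, case $p = 2$ (« Now assume that $p=2$. If $\sqrt{-1} \in K_1$, then we must have
$K_1 = \Q(\zeta_m)$ for $m=2^\alpha$ and some $\alpha \ge 2$ »); proved here] -/
theorem isCMField_sup_of_twoPow_cyclotomic' {α q ν : ℕ} (hα : 2 ≤ α) (hq : q.Prime) (hq2 : q ≠ 2) (hν : 0 < ν)
    (K₁ Ln K₂ : IntermediateField ℚ M) [IsCyclotomicExtension {2 ^ α} ℚ K₁] [IsCyclotomicExtension {q ^ ν} ℚ Ln]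
    (h₂ : K₂ ≤ Ln) [IsTotallyComplex K₂] : IsCMField ↥(K₁ ⊔ K₂) := by
  have hm : 1 < 2 ^ α := Nat.one_lt_two_pow (by omega)
  have hn : 1 < q ^ ν := lt_of_lt_of_le hq.one_lt (Nat.le_self_pow hν.ne' q)
  haveI := isCyclotomicExtension_sup_of_coprime (M := M) hm hn
    (Nat.coprime_pow_primes α ν Nat.prime_two hq (Ne.symm hq2)) K₁ Ln
  letI : Algebra ↥(K₁ ⊔ K₂) ↥(K₁ ⊔ Ln) := (IntermediateField.inclusion (sup_le_sup_left h₂ K₁)).toRingHom.toAlgebra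
  exact isCMField_of_odd_finrank_of_algebra_cyclotomic (K := ↥(K₁ ⊔ K₂)) (M := ↥(K₁ ⊔ Ln))
    (primePow_mul_primePow_tct Nat.prime_two hq (Ne.symm hq2) (by omega : 0 < α) hν).1
    (odd_finrank_sup_sup_two_tct hα hq hq2 hν K₁ Ln K₂ h₂)

/-- **(11f) THE CASE `p = 2`, `K₁` A COPY OF `ℚ(ζ_{2^α})` IN ANY AMBIENT FIELD: `Q(K₁K₂) = 2`** (setting of (11e);
`α ≥ 2`).  « By f) it suffices to show that $K_1(\zeta_n) = \Q(\zeta_{mn})$ has unit index $2$ »: `(K₁ ⊔ Ln : K₁ ⊔ K₂)`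
is odd, `K₁ ⊔ Ln` is `{2^α q^ν}`-cyclotomic ((11a)) with `Q = 2` (`2^α q^ν` is not a prime power and `≢ 2 mod 4` as
`α ≥ 2`; Proposition 1 g), M113 item (3c)), and Proposition 1 f) (M113 item (7f)).
[cite: Lemmermeyer1995, §2 Proposition 1 h) (« h) (see Example 4 below) Let $K_1 \subseteq \Q(\zeta_m)$ and
$K_2 \subseteq \Q(\zeta_n)$ be abelian CM-fields, where $m=p^\mu$
and $n=q^\nu$ are prime powers such that $p \ne q$, and let
$K = K_1K_2$; then $Q(K) = 2$. ») and its proof, case $p = 2$ (« Now $n$ is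
odd and $K_2 \subseteq \Q(\zeta_n)$ is complex, hence
$(\Q(\zeta_n):K_2)$ is odd. By f) it suffices to show that
$K_1(\zeta_n) = \Q(\zeta_{mn})$ has unit index $2$, and this
follows from g). »); proved here] -/
theorem indexRealUnits_sup_eq_two_of_twoPow_cyclotomic' {α q ν : ℕ} (hα : 2 ≤ α) (hq : q.Prime) (hq2 : q ≠ 2)
    (hν : 0 < ν) (K₁ Ln K₂ : IntermediateField ℚ M) [IsCyclotomicExtension {2 ^ α} ℚ K₁]
    [IsCyclotomicExtension {q ^ ν} ℚ Ln] (h₂ : K₂ ≤ Ln) [IsTotallyComplex K₂] :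
    haveI : IsCMField ↥(K₁ ⊔ K₂) := isCMField_sup_of_twoPow_cyclotomic' hα hq hq2 hν K₁ Ln K₂ h₂
    IsCMField.indexRealUnits ↥(K₁ ⊔ K₂) = 2 := by
  have hm : 1 < 2 ^ α := Nat.one_lt_two_pow (by omega)
  have hn : 1 < q ^ ν := lt_of_lt_of_le hq.one_lt (Nat.le_self_pow hν.ne' q)
  haveI := isCyclotomicExtension_sup_of_coprime (M := M) hm hn
    (Nat.coprime_pow_primes α ν Nat.prime_two hq (Ne.symm hq2)) K₁ Ln
  letI : Algebra ↥(K₁ ⊔ K₂) ↥(K₁ ⊔ Ln) := (IntermediateField.inclusion (sup_le_sup_left h₂ K₁)).toRingHom.toAlgebra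
  obtain ⟨h2, hnp⟩ := primePow_mul_primePow_tct Nat.prime_two hq (Ne.symm hq2) (by omega : 0 < α) hν
  have h4 : ¬ (2 ^ α * q ^ ν) % 4 = 2 := by
    have hd : 2 ^ 2 ∣ 2 ^ α * q ^ ν := (pow_dvd_pow 2 hα).mul_right _
    rw [show (2 : ℕ) ^ 2 = 4 by norm_num] at hd
    omega
  exact indexRealUnits_eq_two_of_odd_finrank_cyclotomic (K := ↥(K₁ ⊔ K₂)) (M := ↥(K₁ ⊔ Ln)) h2
    (by rwa [if_neg h4]) (odd_finrank_sup_sup_two_tct hα hq hq2 hν K₁ Ln K₂ h₂)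

/-- **(11g) `κ_{K₁K₂/(K₁K₂)⁺} = 1` IN THE CASE `p = 2`, `K₁` A COPY OF `ℚ(ζ_{2^α})`** (setting of (11e); M113 item
(7g)).
[cite: Lemmermeyer1995, §2 Proposition 1 h) (« and let
$K = K_1K_2$; then $Q(K) = 2$. ») with Proposition 1 b) (« b) (Satz 16, 17) if $Q(L) = 2$ then $\kappa_{L/L^+} = 1$; »); proved here] -/
theorem ker_classGroupExtendedHom_maximalRealSubfield_sup_eq_bot_of_twoPow_cyclotomic' {α q ν : ℕ} (hα : 2 ≤ α)
    (hq : q.Prime) (hq2 : q ≠ 2) (hν : 0 < ν) (K₁ Ln K₂ : IntermediateField ℚ M)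
    [IsCyclotomicExtension {2 ^ α} ℚ K₁] [IsCyclotomicExtension {q ^ ν} ℚ Ln] (h₂ : K₂ ≤ Ln)
    [IsTotallyComplex K₂] :
    haveI : IsCMField ↥(K₁ ⊔ K₂) := isCMField_sup_of_twoPow_cyclotomic' hα hq hq2 hν K₁ Ln K₂ h₂
    (ClassGroup.extendedHom (𝓞 (maximalRealSubfield ↥(K₁ ⊔ K₂))) (𝓞 ↥(K₁ ⊔ K₂))).ker = ⊥ := by
  have hm : 1 < 2 ^ α := Nat.one_lt_two_pow (by omega)
  have hn : 1 < q ^ ν := lt_of_lt_of_le hq.one_lt (Nat.le_self_pow hν.ne' q)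
  haveI := isCyclotomicExtension_sup_of_coprime (M := M) hm hn
    (Nat.coprime_pow_primes α ν Nat.prime_two hq (Ne.symm hq2)) K₁ Ln
  letI : Algebra ↥(K₁ ⊔ K₂) ↥(K₁ ⊔ Ln) := (IntermediateField.inclusion (sup_le_sup_left h₂ K₁)).toRingHom.toAlgebra
  exact ker_classGroupExtendedHom_maximalRealSubfield_eq_bot_of_odd_finrank_cyclotomic (K := ↥(K₁ ⊔ K₂))
    (M := ↥(K₁ ⊔ Ln)) (primePow_mul_primePow_tct Nat.prime_two hq (Ne.symm hq2) (by omega : 0 < α) hν).1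
    (odd_finrank_sup_sup_two_tct hα hq hq2 hν K₁ Ln K₂ h₂)

/-- (11θ) `√-1 ∈ K₁ ≤ Lm = ℚ(ζ_{2^μ})` ⇒ `K₁` is `{2^α}`-cyclotomic over `ℚ`, `2 ≤ α ≤ μ`: item (10b) inside `↥Lm`,
transported along `↥K₁ ≃ₐ[ℚ] ↥(restrict)` (`IsCyclotomicExtension.equiv`). [folklore] (proved here; private helper) -/
private theorem exists_isCyclotomicExtension_of_le_tct {μ : ℕ} (hμ : 2 ≤ μ) (Lm K₁ : IntermediateField ℚ M)
    [IsCyclotomicExtension {2 ^ μ} ℚ Lm] (h₁ : K₁ ≤ Lm) (hi : ∃ x ∈ K₁, x ^ 2 = -1) :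
    ∃ α : ℕ, 2 ≤ α ∧ α ≤ μ ∧ IsCyclotomicExtension {2 ^ α} ℚ K₁ := by
  obtain ⟨x, hx, hx2⟩ := hi
  let e : ↥K₁ ≃ₐ[ℚ] ↥(IntermediateField.restrict h₁) :=
    { toFun := fun y => ⟨⟨y.1, h₁ y.2⟩, (IntermediateField.mem_restrict h₁ _).mpr y.2⟩
      invFun := fun y => ⟨y.1.1, (IntermediateField.mem_restrict h₁ y.1).mp y.2⟩
      left_inv := fun _ => rfl
      right_inv := fun _ => rfl
      map_mul' := fun _ _ => rfl
      map_add' := fun _ _ => rfl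
      commutes' := fun _ => rfl }
  have hx' : ∃ y ∈ IntermediateField.restrict h₁, y ^ 2 = -1 :=
    ⟨⟨x, h₁ hx⟩, (IntermediateField.mem_restrict h₁ _).mpr hx, Subtype.ext hx2⟩
  obtain ⟨α, h2, hαμ, hK⟩ :=
    exists_isCyclotomicExtension_two_pow_of_sq_eq_neg_one (L := ↥Lm) hμ (IntermediateField.restrict h₁) hx'
  exact ⟨α, h2, hαμ, IsCyclotomicExtension.equiv {2 ^ α} ℚ _ e.symm⟩

/-- **(11h) PROPOSITION 1 h), `p = 2`, THE SUB-CASE `√-1 ∈ K₁` AS STATED: `K₁K₂` IS CM** (`μ ≥ 2`, `q` an odd prime,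
`ν > 0`; `M` ANY number field; `Lm, Ln : IntermediateField ℚ M` `{2^μ}`- resp. `{q^ν}`-cyclotomic over `ℚ`; `K₁ ≤ Lm`
with some `x ∈ K₁`, `x² = -1`; `K₂ ≤ Ln` totally complex).  « we must have $K_1 = \Q(\zeta_m)$ for $m=2^\alpha$ and some
$\alpha \ge 2$ »: by item (10b) `K₁` is `{2^α}`-cyclotomic, `2 ≤ α ≤ μ` ((11θ)); then (11e).
[cite: Lemmermeyer1995, §2 Proposition 1 h) (« Let $K_1 \subseteq \Q(\zeta_m)$ and
$K_2 \subseteq \Q(\zeta_n)$ be abelian CM-fields, where $m=p^\mu$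
and $n=q^\nu$ are prime powers such that $p \ne q$, and let
$K = K_1K_2$ ») and its proof, case $p = 2$ (« Now assume that $p=2$. If $\sqrt{-1} \in K_1$, then we must have
$K_1 = \Q(\zeta_m)$ for $m=2^\alpha$ and some $\alpha \ge 2$ »); proved here] -/
theorem isCMField_sup_of_sq_eq_neg_one {μ q ν : ℕ} (hμ : 2 ≤ μ) (hq : q.Prime) (hq2 : q ≠ 2) (hν : 0 < ν)
    (Lm Ln K₁ K₂ : IntermediateField ℚ M) [IsCyclotomicExtension {2 ^ μ} ℚ Lm]
    [IsCyclotomicExtension {q ^ ν} ℚ Ln] (h₁ : K₁ ≤ Lm) (h₂ : K₂ ≤ Ln) (hi : ∃ x ∈ K₁, x ^ 2 = -1)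
    [IsTotallyComplex K₂] : IsCMField ↥(K₁ ⊔ K₂) := by
  obtain ⟨α, hα, -, hK₁⟩ := exists_isCyclotomicExtension_of_le_tct hμ Lm K₁ h₁ hi
  haveI := hK₁
  exact isCMField_sup_of_twoPow_cyclotomic' hα hq hq2 hν K₁ Ln K₂ h₂

/-- **(11i) PROPOSITION 1 h), `p = 2`, THE SUB-CASE `√-1 ∈ K₁` AS STATED: `Q(K₁K₂) = 2`** (setting of (11h); by (10b)
and (11f)).  Together with (11c) this is Proposition 1 h) for every pair `(K₁, K₂)` except the sub-case `√-1 ∉ K₁` of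
`p = 2` ((D80)).
[cite: Lemmermeyer1995, §2 Proposition 1 h) (« h) (see Example 4 below) Let $K_1 \subseteq \Q(\zeta_m)$ and
$K_2 \subseteq \Q(\zeta_n)$ be abelian CM-fields, where $m=p^\mu$
and $n=q^\nu$ are prime powers such that $p \ne q$, and let
$K = K_1K_2$; then $Q(K) = 2$. ») and its proof, case $p = 2$ (« If $\sqrt{-1} \in K_1$, then we must have
$K_1 = \Q(\zeta_m)$ for $m=2^\alpha$ and some $\alpha \ge 2$
(complex subfields of the field of $2^\mu$th roots of unity
containing $\sqrt{-1}$ necessarily have this form) », « Now $n$ is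
odd and $K_2 \subseteq \Q(\zeta_n)$ is complex, hence
$(\Q(\zeta_n):K_2)$ is odd. By f) it suffices to show that
$K_1(\zeta_n) = \Q(\zeta_{mn})$ has unit index $2$, and this
follows from g). »); proved here] -/
theorem indexRealUnits_sup_eq_two_of_sq_eq_neg_one {μ q ν : ℕ} (hμ : 2 ≤ μ) (hq : q.Prime) (hq2 : q ≠ 2)
    (hν : 0 < ν) (Lm Ln K₁ K₂ : IntermediateField ℚ M) [IsCyclotomicExtension {2 ^ μ} ℚ Lm]
    [IsCyclotomicExtension {q ^ ν} ℚ Ln] (h₁ : K₁ ≤ Lm) (h₂ : K₂ ≤ Ln) (hi : ∃ x ∈ K₁, x ^ 2 = -1)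
    [IsTotallyComplex K₂] :
    haveI : IsCMField ↥(K₁ ⊔ K₂) := isCMField_sup_of_sq_eq_neg_one hμ hq hq2 hν Lm Ln K₁ K₂ h₁ h₂ hi
    IsCMField.indexRealUnits ↥(K₁ ⊔ K₂) = 2 := by
  obtain ⟨α, hα, -, hK₁⟩ := exists_isCyclotomicExtension_of_le_tct hμ Lm K₁ h₁ hi
  haveI := hK₁
  exact indexRealUnits_sup_eq_two_of_twoPow_cyclotomic' hα hq hq2 hν K₁ Ln K₂ h₂

/-- **(11j) `κ_{K₁K₂/(K₁K₂)⁺} = 1` IN THE SUB-CASE `√-1 ∈ K₁`** (setting of (11h); by (10b) and (11g)).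
[cite: Lemmermeyer1995, §2 Proposition 1 h) (« and let
$K = K_1K_2$; then $Q(K) = 2$. ») with Proposition 1 b) (« b) (Satz 16, 17) if $Q(L) = 2$ then $\kappa_{L/L^+} = 1$; »); proved here] -/
theorem ker_classGroupExtendedHom_maximalRealSubfield_sup_eq_bot_of_sq_eq_neg_one {μ q ν : ℕ} (hμ : 2 ≤ μ)
    (hq : q.Prime) (hq2 : q ≠ 2) (hν : 0 < ν) (Lm Ln K₁ K₂ : IntermediateField ℚ M)
    [IsCyclotomicExtension {2 ^ μ} ℚ Lm] [IsCyclotomicExtension {q ^ ν} ℚ Ln] (h₁ : K₁ ≤ Lm) (h₂ : K₂ ≤ Ln)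
    (hi : ∃ x ∈ K₁, x ^ 2 = -1) [IsTotallyComplex K₂] :
    haveI : IsCMField ↥(K₁ ⊔ K₂) := isCMField_sup_of_sq_eq_neg_one hμ hq hq2 hν Lm Ln K₁ K₂ h₁ h₂ hi
    (ClassGroup.extendedHom (𝓞 (maximalRealSubfield ↥(K₁ ⊔ K₂))) (𝓞 ↥(K₁ ⊔ K₂))).ker = ⊥ := by
  obtain ⟨α, hα, -, hK₁⟩ := exists_isCyclotomicExtension_of_le_tct hμ Lm K₁ h₁ hi
  haveI := hK₁
  exact ker_classGroupExtendedHom_maximalRealSubfield_sup_eq_bot_of_twoPow_cyclotomic' hα hq hq2 hν K₁ Ln K₂ h₂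

end CompositaAnyAmbient

section SqrtNotMem

/-! ### (12) (v1.1) The sub-case `√-1 ∉ K₁` of `p = 2`; Proposition 1 h) in full -/

variable {M : Type} [Field M] [NumberField M]

/-- (12α) a totally complex intermediate field `E ≤ N` of `M` with `N` `{n}`-cyclotomic over `ℚ` is CM (abelian by
`IsAbelianGalois.tower_bot`, then `IsCMField.of_isAbelianGalois`). [folklore] (proved here; private helper) -/
private theorem isCMField_of_le_cyclotomic_tct {n : ℕ} (N E : IntermediateField ℚ M)
    [IsCyclotomicExtension {n} ℚ N] (hEN : E ≤ N) [IsTotallyComplex E] : IsCMField ↥E := by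
  letI : Algebra ↥E ↥N := (IntermediateField.inclusion hEN).toRingHom.toAlgebra
  haveI : IsScalarTower ℚ ↥E ↥N := IsScalarTower.of_algebraMap_eq (fun _ => rfl)
  haveI := IsCyclotomicExtension.isAbelianGalois ({n} : Set ℕ) ℚ ↥N
  haveI : IsAbelianGalois ℚ ↥E := IsAbelianGalois.tower_bot ℚ ↥E ↥N
  infer_instance

/-- (12β) `i² = -1 ⇒ [ℚ(i) : ℚ] = 2` (`i` is a primitive `4`-th root of unity; `Polynomial.cyclotomic_eq_minpoly_rat`).
[folklore] (proved here; private helper) -/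
private theorem finrank_adjoin_sq_eq_neg_one_tct {i : M} (hi : i ^ 2 = -1) : Module.finrank ℚ ℚ⟮i⟯ = 2 := by
  have ho : orderOf i = 2 ^ (1 + 1) := by
    apply orderOf_eq_prime_pow
    · rw [pow_one, hi]; norm_num
    · rw [show (2 : ℕ) ^ (1 + 1) = 2 * 2 by norm_num, pow_mul, hi]; norm_num
  have h4 : IsPrimitiveRoot i 4 := by
    have := IsPrimitiveRoot.orderOf i
    rwa [ho] at this
  rw [IntermediateField.adjoin.finrank (Algebra.IsIntegral.isIntegral _),
    ← Polynomial.cyclotomic_eq_minpoly_rat h4 (by norm_num), Polynomial.natDegree_cyclotomic]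
  decide

/-- (12γ) `i² = -1`, `i ∉ E ⇒ [E(i) : ℚ] = 2 [E : ℚ]` (`E(i) = E ⊔ ℚ⟮i⟯`; `≤` by `IntermediateField.finrank_sup_le`,
`≥` because `E < E ⊔ ℚ⟮i⟯` in the tower over `E`). [folklore] (proved here; private helper) -/
private theorem finrank_sup_adjoin_tct (E : IntermediateField ℚ M) {i : M} (hi : i ^ 2 = -1) (hiE : i ∉ E) :
    Module.finrank ℚ ↥(E ⊔ ℚ⟮i⟯) = 2 * Module.finrank ℚ ↥E := by
  apply le_antisymm
  · have := IntermediateField.finrank_sup_le E ℚ⟮i⟯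
    rw [finrank_adjoin_sq_eq_neg_one_tct hi] at this
    omega
  · letI : Algebra ↥E ↥(E ⊔ ℚ⟮i⟯) :=
      (IntermediateField.inclusion (le_sup_left : E ≤ E ⊔ ℚ⟮i⟯)).toRingHom.toAlgebra
    haveI : IsScalarTower ℚ ↥E ↥(E ⊔ ℚ⟮i⟯) := IsScalarTower.of_algebraMap_eq (fun _ => rfl)
    haveI : Module.Finite ↥E ↥(E ⊔ ℚ⟮i⟯) := Module.Finite.of_restrictScalars_finite ℚ _ _
    haveI : Module.Free ↥E ↥(E ⊔ ℚ⟮i⟯) := Module.Free.of_divisionRing _ _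
    have ht := Module.finrank_mul_finrank ℚ ↥E ↥(E ⊔ ℚ⟮i⟯)
    have hpos' : 0 < Module.finrank ℚ ↥(E ⊔ ℚ⟮i⟯) := Module.finrank_pos
    have hpos : 0 < Module.finrank ↥E ↥(E ⊔ ℚ⟮i⟯) := by
      rcases Nat.eq_zero_or_pos (Module.finrank ↥E ↥(E ⊔ ℚ⟮i⟯)) with h0 | h0
      · rw [h0, mul_zero] at ht; omega
      · exact h0
    have hne : Module.finrank ↥E ↥(E ⊔ ℚ⟮i⟯) ≠ 1 := by
      intro h1
      rw [h1, mul_one] at ht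
      have hEq := IntermediateField.eq_of_le_of_finrank_eq (le_sup_left : E ≤ E ⊔ ℚ⟮i⟯) ht
      apply hiE
      rw [hEq]
      exact (le_sup_right : ℚ⟮i⟯ ≤ E ⊔ ℚ⟮i⟯) (IntermediateField.mem_adjoin_simple_self ℚ i)
    have h2 : 2 ≤ Module.finrank ↥E ↥(E ⊔ ℚ⟮i⟯) := by omega
    calc 2 * Module.finrank ℚ ↥E ≤ Module.finrank ↥E ↥(E ⊔ ℚ⟮i⟯) * Module.finrank ℚ ↥E :=
          Nat.mul_le_mul_right _ h2
      _ = Module.finrank ℚ ↥(E ⊔ ℚ⟮i⟯) := by rw [mul_comm, ht]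

/-- (12δ) in a field without `√-1`, `w ^ 2 ^ a = 1 ⇒ w = ±1`. [folklore] (proved here; private helper) -/
private theorem eq_one_or_eq_neg_one_tct {F : Type*} [Field F] (hF : ¬ ∃ x : F, x ^ 2 = -1) :
    ∀ (a : ℕ) (w : F), w ^ 2 ^ a = 1 → w = 1 ∨ w = -1 := by
  intro a
  induction a with
  | zero => intro w hw; left; simpa using hw
  | succ a ih =>
    intro w hw
    rw [pow_succ', pow_mul] at hw
    rcases ih (w ^ 2) hw with h | h
    · exact sq_eq_sq_iff_eq_or_eq_neg.mp (by rw [h, one_pow])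
    · exact absurd ⟨w, h⟩ hF

/-- (12ε) the relative form of (12γ): `F = E ⊔ ℚ⟮i⟯ ≥ E`, `i ∉ E ⇒ [F : E] = 2` for the inclusion algebra structure
`↥E → ↥F` (used with `E = K₁ ⊔ K₂`, `F = K̃₁ ⊔ K₂`: `[K̃₁K₂ : K₁K₂] = 2`). [folklore] (proved here; private helper) -/
private theorem finrank_eq_two_of_sup_adjoin_tct (E F : IntermediateField ℚ M) {i : M} (hi : i ^ 2 = -1)
    (hiE : i ∉ E) (hEF : E ≤ F) (hF : F = E ⊔ ℚ⟮i⟯) :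
    letI : Algebra ↥E ↥F := (IntermediateField.inclusion hEF).toRingHom.toAlgebra
    Module.finrank ↥E ↥F = 2 := by
  letI : Algebra ↥E ↥F := (IntermediateField.inclusion hEF).toRingHom.toAlgebra
  haveI : IsScalarTower ℚ ↥E ↥F := IsScalarTower.of_algebraMap_eq (fun _ => rfl)
  haveI : Module.Finite ↥E ↥F := Module.Finite.of_restrictScalars_finite ℚ _ _
  haveI : Module.Free ↥E ↥F := Module.Free.of_divisionRing _ _
  have ht := Module.finrank_mul_finrank ℚ ↥E ↥F
  have hfe : Module.finrank ℚ ↥F = Module.finrank ℚ ↥(E ⊔ ℚ⟮i⟯) :=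
    (IntermediateField.equivOfEq hF).toLinearEquiv.finrank_eq
  rw [hfe, finrank_sup_adjoin_tct E hi hiE] at ht
  have hpos : 0 < Module.finrank ℚ ↥E := Module.finrank_pos
  exact Nat.eq_of_mul_eq_mul_left hpos (ht.trans (mul_comm _ _))

/-- (12ζ) `i ∉ K₁K₂`: with `K̃₁ = K₁ ⊔ ℚ⟮i⟯` `{2^α}`-cyclotomic, `Ln` `{q^ν}`-cyclotomic, `K̃₁ ⊔ Ln`
`{2^α q^ν}`-cyclotomic and `K₂ ≤ Ln`: `i ∈ K₁ ⊔ K₂` would give `K̃₁ ⊔ Ln = K₁ ⊔ Ln`, of degree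
`≤ [K₁ : ℚ][Ln : ℚ] < 2 [K₁ : ℚ] φ(q^ν) = φ(2^α) φ(q^ν)` ((12γ), `IsCyclotomicExtension.finrank`, `Nat.totient_mul`).
[folklore] (proved here; private helper) -/
private theorem not_mem_sup_tct {α q ν : ℕ} (hq : q.Prime) (hcop : (2 ^ α).Coprime (q ^ ν))
    (K₁ Ln K₂ : IntermediateField ℚ M) {i : M} (hi : i ^ 2 = -1) (hiK₁ : i ∉ K₁)
    [IsCyclotomicExtension {2 ^ α} ℚ ↥(K₁ ⊔ ℚ⟮i⟯)] [IsCyclotomicExtension {q ^ ν} ℚ ↥Ln]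
    [IsCyclotomicExtension {2 ^ α * q ^ ν} ℚ ↥((K₁ ⊔ ℚ⟮i⟯) ⊔ Ln)] (h₂ : K₂ ≤ Ln) : i ∉ K₁ ⊔ K₂ := by
  haveI : NeZero (2 ^ α) := ⟨by positivity⟩
  haveI : NeZero (q ^ ν) := ⟨(pow_pos hq.pos ν).ne'⟩
  haveI : NeZero (2 ^ α * q ^ ν) := ⟨(Nat.mul_pos (NeZero.pos _) (NeZero.pos (q ^ ν))).ne'⟩
  have hdegKt := finrank_sup_adjoin_tct K₁ hi hiK₁
  have hdeg1 : Module.finrank ℚ ↥(K₁ ⊔ ℚ⟮i⟯) = Nat.totient (2 ^ α) :=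
    IsCyclotomicExtension.finrank (n := 2 ^ α) ↥(K₁ ⊔ ℚ⟮i⟯) (Polynomial.cyclotomic.irreducible_rat (NeZero.pos _))
  have hdeg2 : Module.finrank ℚ ↥Ln = Nat.totient (q ^ ν) :=
    IsCyclotomicExtension.finrank (n := q ^ ν) ↥Ln (Polynomial.cyclotomic.irreducible_rat (NeZero.pos _))
  have hdeg : Module.finrank ℚ ↥((K₁ ⊔ ℚ⟮i⟯) ⊔ Ln) = Nat.totient (2 ^ α) * Nat.totient (q ^ ν) := by
    rw [IsCyclotomicExtension.finrank (n := 2 ^ α * q ^ ν) ↥((K₁ ⊔ ℚ⟮i⟯) ⊔ Ln)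
      (Polynomial.cyclotomic.irreducible_rat (NeZero.pos _)), Nat.totient_mul hcop]
  have htpos : 0 < Nat.totient (q ^ ν) := Nat.totient_pos.mpr (NeZero.pos _)
  have hK₁pos : 0 < Module.finrank ℚ ↥K₁ := Module.finrank_pos
  intro hmem
  have hle : (K₁ ⊔ ℚ⟮i⟯) ⊔ Ln = K₁ ⊔ Ln := le_antisymm
    (sup_le (sup_le le_sup_left (IntermediateField.adjoin_simple_le_iff.mpr ((sup_le_sup_left h₂ K₁) hmem)))
      le_sup_right)
    (sup_le_sup_right le_sup_left _)
  have hfe : Module.finrank ℚ ↥((K₁ ⊔ ℚ⟮i⟯) ⊔ Ln) = Module.finrank ℚ ↥(K₁ ⊔ Ln) :=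
    (IntermediateField.equivOfEq hle).toLinearEquiv.finrank_eq
  have hsup := IntermediateField.finrank_sup_le K₁ Ln
  rw [← hfe, hdeg, hdeg2, ← hdeg1, hdegKt] at hsup
  nlinarith

/-- (12η) THE NON-TRIVIAL AUTOMORPHISM CANNOT INVERT `ζ`: for intermediate fields `K₁ ≤ A`, `B` of `M` with `A`
`{n}`-cyclotomic over `ℚ` and `K₁` totally complex, a `ℚ`-automorphism `τ` of `A ⊔ B` fixing `K₁` pointwise does not
send a primitive `n`-th root of unity `ζ ∈ A` to `ζ⁻¹` — else `τ|A` (`AlgEquiv.restrictNormal`) agrees with complex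
conjugation through any embedding `φ : A → ℂ` on `ζ` (`|φ ζ| = 1`), hence everywhere (`IsPrimitiveRoot.powerBasis`,
`PowerBasis.algHom_ext` over `ℚ`), and `φ|K₁` would be a real embedding of `K₁`
(`IsTotallyComplex.complexEmbedding_not_isReal`).  Our derived form of « the observation that the non-trivial automorphism of
$\Q(\zeta_m)/K_1$ maps $\zeta_m$ to $-\zeta_m^{-1}$ » ((D82)). [folklore] (proved here; private helper) -/
private theorem false_of_inv_tct {n : ℕ} [NeZero n] (A B K₁ : IntermediateField ℚ M)
    [IsCyclotomicExtension {n} ℚ ↥A] (hK₁A : K₁ ≤ A) [IsTotallyComplex ↥K₁] (τ : ↥(A ⊔ B) ≃ₐ[ℚ] ↥(A ⊔ B))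
    (hfix : ∀ y : ↥(A ⊔ B), (y : M) ∈ K₁ → τ y = y) (ζ : ↥A) (hζ : IsPrimitiveRoot ζ n)
    (hτζ : τ (IntermediateField.inclusion (le_sup_left : A ≤ A ⊔ B) ζ) =
      (IntermediateField.inclusion (le_sup_left : A ≤ A ⊔ B) ζ)⁻¹) : False := by
  haveI : IsGalois ℚ ↥A := IsCyclotomicExtension.isGalois {n} ℚ ↥A
  letI : Algebra ↥A ↥(A ⊔ B) :=
    (IntermediateField.inclusion (le_sup_left : A ≤ A ⊔ B)).toRingHom.toAlgebra
  haveI : IsScalarTower ℚ ↥A ↥(A ⊔ B) := IsScalarTower.of_algebraMap_eq (fun _ => rfl)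
  let τ₁ : ↥A ≃ₐ[ℚ] ↥A := τ.restrictNormal ↥A
  have hτ₁ : ∀ w, algebraMap ↥A ↥(A ⊔ B) (τ₁ w) = τ (algebraMap ↥A ↥(A ⊔ B) w) := fun w =>
    AlgEquiv.restrictNormal_commutes τ _ w
  have hτ₁ζ : τ₁ ζ = ζ⁻¹ := by
    apply (algebraMap ↥A ↥(A ⊔ B)).injective
    rw [hτ₁, map_inv₀]
    exact hτζ
  -- under any complex embedding `φ` of `A`, `τ₁` is complex conjugation
  obtain ⟨φ⟩ : Nonempty (↥A →+* ℂ) := inferInstance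
  have hφz : ‖φ ζ‖ = 1 :=
    Complex.norm_eq_one_of_pow_eq_one (by rw [← map_pow, hζ.pow_eq_one, map_one]) (NeZero.ne _)
  have heq : ((starRingEnd ℂ).comp φ).toRatAlgHom = (φ.comp τ₁.toRingEquiv.toRingHom).toRatAlgHom := by
    apply (hζ.powerBasis ℚ).algHom_ext
    rw [IsPrimitiveRoot.powerBasis_gen, RingHom.toRatAlgHom_apply, RingHom.toRatAlgHom_apply,
      RingHom.comp_apply, RingHom.comp_apply]
    show (starRingEnd ℂ) (φ ζ) = φ (τ₁ ζ)
    rw [hτ₁ζ, map_inv₀, Complex.inv_eq_conj hφz]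
  -- and `τ₁` fixes `K₁`: a real embedding of the totally complex field `K₁`
  letI : Algebra ↥K₁ ↥A := (IntermediateField.inclusion hK₁A).toRingHom.toAlgebra
  have hfix₁ : ∀ w : ↥K₁, τ₁ (algebraMap ↥K₁ ↥A w) = algebraMap ↥K₁ ↥A w := by
    intro w
    apply (algebraMap ↥A ↥(A ⊔ B)).injective
    rw [hτ₁]
    exact hfix _ w.2
  have hreal : ComplexEmbedding.IsReal (φ.comp (algebraMap ↥K₁ ↥A)) := by
    rw [ComplexEmbedding.isReal_iff]
    ext1 w
    rw [ComplexEmbedding.conjugate_coe_eq, RingHom.comp_apply]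
    have h1 := AlgHom.congr_fun heq (algebraMap ↥K₁ ↥A w)
    rw [RingHom.toRatAlgHom_apply, RingHom.toRatAlgHom_apply, RingHom.comp_apply, RingHom.comp_apply] at h1
    change (starRingEnd ℂ) (φ (algebraMap ↥K₁ ↥A w)) = φ (τ₁ (algebraMap ↥K₁ ↥A w)) at h1
    rw [h1, hfix₁]
  exact IsTotallyComplex.complexEmbedding_not_isReal _ hreal

/-- (12θ) ENGINE OF THE SUB-CASE `√-1 ∉ K₁` (`μ = k + 2 ≥ 2`, `q` an odd prime, `ν > 0`, `K₁ ≤ Lm`, `K₂ ≤ Ln` totally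
complex, `¬ ∃ x ∈ K₁, x² = -1`, and the CM structure of `K₁ ⊔ K₂` as an instance hypothesis): `Q(K₁ ⊔ K₂) = 2`.
Steps as in the module docstring, item (12b): `i = ζ_{2^μ}^(2^k) ∈ Lm`, `K̃₁ = K₁ ⊔ ℚ⟮i⟯` `{2^α}`-cyclotomic ((11θ)),
`i ∉ K = K₁ ⊔ K₂` ((12ζ)), `L = K̃₁ ⊔ K₂ ⊇ K` Galois of degree `2` ((12ε); abelian inside `K̃₁ ⊔ Ln`), `Q(L) = 2`
((11f)); `N_{L/K}(ζ_{2^α}) = ±1` ((12δ)), `= 1` excluded by `Algebra.norm_eq_prod_automorphisms` and (12η), `= -1`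
is not `t²` for a root of unity `t ∈ K`; conclude by Proposition 1 e) = M113 (6e)
`indexRealUnits_eq_two_of_tower_of_norm`.  « If $\sqrt{-1} \not\in K_1$, let $\widetilde{K}_1 = K_1(i)$;
then $\widetilde{K}_1 = \Q(\zeta_m)$ for $m=2^\alpha$ and some
$\alpha \ge 2$, and in the last paragraph we have seen that
$Q(\widetilde{K}_1K_2) = 2$. Hence we only need to show that the
norm map » … « is onto: since $(W_{\widetilde{K}_1K_2}:W_{\widetilde{K}_1})$ is odd,
this implies $2 = Q(\widetilde{K}_1K_2) \mid Q(K_1K_2)$ by e). » [folklore] (proved here; private helper) -/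
private theorem indexRealUnits_sup_eq_two_of_not_sq_tct {μ q ν : ℕ} (hμ : 2 ≤ μ) (hq : q.Prime) (hq2 : q ≠ 2)
    (hν : 0 < ν) (Lm Ln K₁ K₂ : IntermediateField ℚ M) [IsCyclotomicExtension {2 ^ μ} ℚ Lm]
    [IsCyclotomicExtension {q ^ ν} ℚ Ln] (h₁ : K₁ ≤ Lm) (h₂ : K₂ ≤ Ln) (hi : ¬ ∃ x ∈ K₁, x ^ 2 = -1)
    [IsTotallyComplex K₁] [IsTotallyComplex K₂] [IsCMField ↥(K₁ ⊔ K₂)] :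
    IsCMField.indexRealUnits ↥(K₁ ⊔ K₂) = 2 := by
  classical
  obtain ⟨k, rfl⟩ : ∃ k, μ = k + 2 := ⟨μ - 2, by omega⟩
  haveI hne : NeZero (2 ^ (k + 2)) := ⟨by positivity⟩
  -- a square root `i ∈ Lm` of `-1`; it is not in `K₁`
  obtain ⟨i, hiLm, hi2⟩ : ∃ i ∈ Lm, i ^ 2 = -1 := by
    set ζ := IsCyclotomicExtension.zeta (2 ^ (k + 2)) ℚ ↥Lm
    have hζ : IsPrimitiveRoot (ζ : M) (2 ^ (k + 2)) :=
      IsPrimitiveRoot.coe_submonoidClass_iff.mpr (IsCyclotomicExtension.zeta_spec (2 ^ (k + 2)) ℚ ↥Lm)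
    have h2 : IsPrimitiveRoot ((ζ : M) ^ 2 ^ (k + 1)) 2 := hζ.pow (NeZero.pos _) (by ring)
    refine ⟨(ζ : M) ^ 2 ^ k, pow_mem ζ.2 _, ?_⟩
    rw [← pow_mul, ← pow_succ]
    exact h2.eq_neg_one_of_two_right
  have hiK₁ : i ∉ K₁ := fun h => hi ⟨i, h, hi2⟩
  -- `K̃₁ = K₁(i)` is `{2 ^ α}`-cyclotomic, `α ≥ 2`
  have hKt : K₁ ⊔ ℚ⟮i⟯ ≤ Lm := sup_le h₁ (IntermediateField.adjoin_simple_le_iff.mpr hiLm)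
  obtain ⟨α, hα, -, hcyc⟩ := exists_isCyclotomicExtension_of_le_tct (by omega : 2 ≤ k + 2) Lm (K₁ ⊔ ℚ⟮i⟯) hKt
    ⟨i, (le_sup_right : ℚ⟮i⟯ ≤ K₁ ⊔ ℚ⟮i⟯) (IntermediateField.mem_adjoin_simple_self ℚ i), hi2⟩
  haveI := hcyc
  haveI hne' : NeZero (2 ^ α) := ⟨by positivity⟩
  have hm : 1 < 2 ^ α := Nat.one_lt_two_pow (by omega)
  have hn : 1 < q ^ ν := lt_of_lt_of_le hq.one_lt (Nat.le_self_pow hν.ne' q)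
  have hcop : (2 ^ α).Coprime (q ^ ν) := Nat.coprime_pow_primes α ν Nat.prime_two hq (Ne.symm hq2)
  haveI := isCyclotomicExtension_sup_of_coprime (M := M) hm hn hcop (K₁ ⊔ ℚ⟮i⟯) Ln
  have hiK : i ∉ K₁ ⊔ K₂ := not_mem_sup_tct hq hcop K₁ Ln K₂ hi2 hiK₁ h₂
  -- the tower `K = K₁K₂ ⊆ L = K̃₁K₂`; `Q(L) = 2`
  have hKL : K₁ ⊔ K₂ ≤ (K₁ ⊔ ℚ⟮i⟯) ⊔ K₂ := sup_le_sup_right le_sup_left K₂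
  letI : Algebra ↥(K₁ ⊔ K₂) ↥((K₁ ⊔ ℚ⟮i⟯) ⊔ K₂) := (IntermediateField.inclusion hKL).toRingHom.toAlgebra
  haveI : IsScalarTower ℚ ↥(K₁ ⊔ K₂) ↥((K₁ ⊔ ℚ⟮i⟯) ⊔ K₂) := IsScalarTower.of_algebraMap_eq (fun _ => rfl)
  haveI : IsCMField ↥((K₁ ⊔ ℚ⟮i⟯) ⊔ K₂) := isCMField_sup_of_twoPow_cyclotomic' hα hq hq2 hν (K₁ ⊔ ℚ⟮i⟯) Ln K₂ h₂
  have hQL : IsCMField.indexRealUnits ↥((K₁ ⊔ ℚ⟮i⟯) ⊔ K₂) = 2 :=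
    indexRealUnits_sup_eq_two_of_twoPow_cyclotomic' hα hq hq2 hν (K₁ ⊔ ℚ⟮i⟯) Ln K₂ h₂
  refine indexRealUnits_eq_two_of_tower_of_norm (K := ↥(K₁ ⊔ K₂)) (L := ↥((K₁ ⊔ ℚ⟮i⟯) ⊔ K₂)) ?_ hQL
  -- `L/K` is Galois of degree `2`
  haveI : IsGalois ℚ ↥((K₁ ⊔ ℚ⟮i⟯) ⊔ K₂) := by
    letI : Algebra ↥((K₁ ⊔ ℚ⟮i⟯) ⊔ K₂) ↥((K₁ ⊔ ℚ⟮i⟯) ⊔ Ln) :=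
      (IntermediateField.inclusion (sup_le_sup_left h₂ _)).toRingHom.toAlgebra
    haveI : IsScalarTower ℚ ↥((K₁ ⊔ ℚ⟮i⟯) ⊔ K₂) ↥((K₁ ⊔ ℚ⟮i⟯) ⊔ Ln) :=
      IsScalarTower.of_algebraMap_eq (fun _ => rfl)
    haveI := IsCyclotomicExtension.isAbelianGalois ({2 ^ α * q ^ ν} : Set ℕ) ℚ ↥((K₁ ⊔ ℚ⟮i⟯) ⊔ Ln)
    haveI : IsAbelianGalois ℚ ↥((K₁ ⊔ ℚ⟮i⟯) ⊔ K₂) := IsAbelianGalois.tower_bot ℚ _ ↥((K₁ ⊔ ℚ⟮i⟯) ⊔ Ln)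
    infer_instance
  haveI : IsGalois ↥(K₁ ⊔ K₂) ↥((K₁ ⊔ ℚ⟮i⟯) ⊔ K₂) := IsGalois.tower_top_of_isGalois ℚ _ _
  haveI : Module.Finite ↥(K₁ ⊔ K₂) ↥((K₁ ⊔ ℚ⟮i⟯) ⊔ K₂) := Module.Finite.of_restrictScalars_finite ℚ _ _
  have hfin2 : Module.finrank ↥(K₁ ⊔ K₂) ↥((K₁ ⊔ ℚ⟮i⟯) ⊔ K₂) = 2 :=
    finrank_eq_two_of_sup_adjoin_tct (K₁ ⊔ K₂) ((K₁ ⊔ ℚ⟮i⟯) ⊔ K₂) hi2 hiK hKL (sup_right_comm K₁ ℚ⟮i⟯ K₂)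
  -- the root of unity `ζ_{2^α} ∈ K̃₁ ⊆ L`
  set ζα := IsCyclotomicExtension.zeta (2 ^ α) ℚ ↥(K₁ ⊔ ℚ⟮i⟯) with hζαdef
  have hζα : IsPrimitiveRoot ζα (2 ^ α) := IsCyclotomicExtension.zeta_spec (2 ^ α) ℚ _
  set z : ↥((K₁ ⊔ ℚ⟮i⟯) ⊔ K₂) :=
    IntermediateField.inclusion (le_sup_left : K₁ ⊔ ℚ⟮i⟯ ≤ (K₁ ⊔ ℚ⟮i⟯) ⊔ K₂) ζα with hzdef
  have hz : IsPrimitiveRoot z (2 ^ α) :=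
    hζα.map_of_injective (f := IntermediateField.inclusion (le_sup_left : K₁ ⊔ ℚ⟮i⟯ ≤ (K₁ ⊔ ℚ⟮i⟯) ⊔ K₂))
      (IntermediateField.inclusion (le_sup_left : K₁ ⊔ ℚ⟮i⟯ ≤ (K₁ ⊔ ℚ⟮i⟯) ⊔ K₂)).toRingHom.injective
  have hz1 : z ^ 2 ^ α = 1 := hz.pow_eq_one
  have hzu : IsUnit z := hz.isUnit (NeZero.ne _)
  refine ⟨hzu.unit, isOfFinOrder_iff_pow_eq_one.mpr ⟨2 ^ α, NeZero.pos _, Units.ext ?_⟩, ?_⟩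
  · rw [Units.val_pow_eq_pow_val, IsUnit.unit_spec, hz1, Units.val_one]
  rintro ⟨t, -, ht⟩
  rw [IsUnit.unit_spec] at ht
  -- no square root of `-1` in `K`
  have hKf : ¬ ∃ x : ↥(K₁ ⊔ K₂), x ^ 2 = -1 := by
    rintro ⟨x, hx⟩
    have hx' : (x : M) ^ 2 = i ^ 2 := by
      rw [hi2]; exact_mod_cast congrArg Subtype.val hx
    rcases sq_eq_sq_iff_eq_or_eq_neg.mp hx' with h | h
    · exact hiK (h ▸ x.2)
    · have := neg_mem x.2
      rw [h, neg_neg] at this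
      exact hiK this
  -- `N_{L/K} z = ±1`, and `-1 = t²` is excluded
  have hN1 : (Algebra.norm ↥(K₁ ⊔ K₂) z) ^ 2 ^ α = 1 := by rw [← map_pow, hz1, map_one]
  rcases eq_one_or_eq_neg_one_tct hKf α _ hN1 with hN | hN
  swap
  · rw [hN] at ht
    exact hKf ⟨(t : ↥(K₁ ⊔ K₂)), ht.symm⟩
  -- `N z = 1` is impossible: the non-trivial automorphism would induce complex conjugation on `K̃₁ ⊇ K₁`
  have hcard : (Finset.univ : Finset (↥((K₁ ⊔ ℚ⟮i⟯) ⊔ K₂) ≃ₐ[↥(K₁ ⊔ K₂)] ↥((K₁ ⊔ ℚ⟮i⟯) ⊔ K₂))).card = 2 := by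
    rw [Finset.card_univ, ← Nat.card_eq_fintype_card, IsGalois.card_aut_eq_finrank, hfin2]
  obtain ⟨x, y, hxy, huniv⟩ := Finset.card_eq_two.mp hcard
  have hprod := Algebra.norm_eq_prod_automorphisms ↥(K₁ ⊔ K₂) z
  rw [hN, map_one, huniv, Finset.prod_pair hxy] at hprod
  obtain ⟨τ, hτz⟩ : ∃ τ : ↥((K₁ ⊔ ℚ⟮i⟯) ⊔ K₂) ≃ₐ[↥(K₁ ⊔ K₂)] ↥((K₁ ⊔ ℚ⟮i⟯) ⊔ K₂), z * τ z = 1 := by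
    have h1 : (1 : _ ≃ₐ[↥(K₁ ⊔ K₂)] _) ∈ ({x, y} : Finset _) := huniv ▸ Finset.mem_univ _
    rcases Finset.mem_insert.mp h1 with h | h
    · refine ⟨y, ?_⟩
      rw [← h, AlgEquiv.one_apply] at hprod; exact hprod.symm
    · rw [Finset.mem_singleton] at h
      refine ⟨x, ?_⟩
      rw [← h, AlgEquiv.one_apply, mul_comm] at hprod; exact hprod.symm
  have hτz' : τ z = z⁻¹ := eq_inv_of_mul_eq_one_right hτz
  refine false_of_inv_tct (K₁ ⊔ ℚ⟮i⟯) K₂ K₁ le_sup_left (τ.restrictScalars ℚ) (fun w hw => ?_) ζα hζα ?_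
  · have hw' : w = algebraMap ↥(K₁ ⊔ K₂) ↥((K₁ ⊔ ℚ⟮i⟯) ⊔ K₂) ⟨(w : M), (le_sup_left : K₁ ≤ K₁ ⊔ K₂) hw⟩ :=
      Subtype.ext rfl
    rw [AlgEquiv.restrictScalars_apply, hw']
    exact τ.commutes _
  · rw [AlgEquiv.restrictScalars_apply]
    exact hτz'

/-- **(12a) PROPOSITION 1 h), THE COMPOSITUM `K₁K₂` IS CM — ANY TWO DISTINCT PRIMES, ANY AMBIENT FIELD** (`p ≠ q`
primes, `μ, ν > 0`; `M` any number field, `Lm, Ln ≤ M` `{p^μ}`-, `{q^ν}`-cyclotomic over `ℚ`, `K₁ ≤ Lm` totally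
complex, `K₂ ≤ Ln`): `K₁ ⊔ K₂` is CM — a totally complex subfield (it contains `K₁`) of the `{p^μ q^ν}`-cyclotomic,
hence abelian, field `Lm ⊔ Ln` ((11a), (12α)).  The CM structure the paper presupposes in « Let $K_1 \subseteq \Q(\zeta_m)$ and
$K_2 \subseteq \Q(\zeta_n)$ be abelian CM-fields, where $m=p^\mu$
and $n=q^\nu$ are prime powers such that $p \ne q$, and let
$K = K_1K_2$ ».
[cite: Lemmermeyer1995, §2 Proposition 1 h) (« Let $K_1 \subseteq \Q(\zeta_m)$ and
$K_2 \subseteq \Q(\zeta_n)$ be abelian CM-fields, where $m=p^\mu$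
and $n=q^\nu$ are prime powers such that $p \ne q$, and let
$K = K_1K_2$ »); proved here] -/
theorem isCMField_sup_of_le_cyclotomic {p q μ ν : ℕ} (hp : p.Prime) (hq : q.Prime) (hpq : p ≠ q) (hμ : 0 < μ)
    (hν : 0 < ν) (Lm Ln K₁ K₂ : IntermediateField ℚ M) [IsCyclotomicExtension {p ^ μ} ℚ Lm]
    [IsCyclotomicExtension {q ^ ν} ℚ Ln] (h₁ : K₁ ≤ Lm) (h₂ : K₂ ≤ Ln) [IsTotallyComplex K₁] :
    IsCMField ↥(K₁ ⊔ K₂) := by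
  have hm : 1 < p ^ μ := lt_of_lt_of_le hp.one_lt (Nat.le_self_pow hμ.ne' p)
  have hn : 1 < q ^ ν := lt_of_lt_of_le hq.one_lt (Nat.le_self_pow hν.ne' q)
  haveI := isCyclotomicExtension_sup_of_coprime (M := M) hm hn (Nat.coprime_pow_primes μ ν hp hq hpq) Lm Ln
  letI : Algebra ↥K₁ ↥(K₁ ⊔ K₂) :=
    (IntermediateField.inclusion (le_sup_left : K₁ ≤ K₁ ⊔ K₂)).toRingHom.toAlgebra
  haveI : IsTotallyComplex ↥(K₁ ⊔ K₂) := isTotallyComplex_of_algebra ↥K₁ ↥(K₁ ⊔ K₂)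
  exact isCMField_of_le_cyclotomic_tct (n := p ^ μ * q ^ ν) (Lm ⊔ Ln) (K₁ ⊔ K₂) (sup_le_sup h₁ h₂)

/-- **(12b) PROPOSITION 1 h) FOR `p = 2`, BOTH SUB-CASES: `Q(K₁K₂) = 2`** (`μ ≥ 2`, `q` an odd prime, `ν > 0`; `M` any
number field, `Lm, Ln ≤ M` `{2^μ}`-, `{q^ν}`-cyclotomic over `ℚ`, `K₁ ≤ Lm`, `K₂ ≤ Ln` totally complex; the CM
structure of `K₁ ⊔ K₂` is (12a), supplied by `haveI` in the statement).  `√-1 ∈ K₁`: item (11i); `√-1 ∉ K₁`: the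
engine (12θ) — `K̃₁ = K₁(i)`, `Q(K̃₁K₂) = 2`, `[K̃₁K₂ : K₁K₂] = 2`, `N(ζ_{2^α}) = -1`, Proposition 1 e) (M113 (6e));
(D82).
[cite: Lemmermeyer1995, §2 proof of Proposition 1 h) (« Now assume that $p=2$. » … « If $\sqrt{-1} \not\in K_1$, let $\widetilde{K}_1 = K_1(i)$;
then $\widetilde{K}_1 = \Q(\zeta_m)$ for $m=2^\alpha$ and some
$\alpha \ge 2$, and in the last paragraph we have seen that
$Q(\widetilde{K}_1K_2) = 2$. Hence we only need to show that the
norm map » … « is onto: since $(W_{\widetilde{K}_1K_2}:W_{\widetilde{K}_1})$ is odd,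
this implies $2 = Q(\widetilde{K}_1K_2) \mid Q(K_1K_2)$ by e). » « But
the observation that the non-trivial automorphism of
$\Q(\zeta_m)/K_1$ maps $\zeta_m$ to $-\zeta_m^{-1}$ implies
at once that $N(\zeta_m) = -1$, and $-1$ generates
$W^{}_{K_1}/W_{K_1}^2$. »); proved here] -/
theorem indexRealUnits_sup_eq_two_of_le_twoPow_cyclotomic {μ q ν : ℕ} (hμ : 2 ≤ μ) (hq : q.Prime) (hq2 : q ≠ 2)
    (hν : 0 < ν) (Lm Ln K₁ K₂ : IntermediateField ℚ M) [IsCyclotomicExtension {2 ^ μ} ℚ Lm]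
    [IsCyclotomicExtension {q ^ ν} ℚ Ln] (h₁ : K₁ ≤ Lm) (h₂ : K₂ ≤ Ln) [IsTotallyComplex K₁]
    [IsTotallyComplex K₂] :
    haveI : IsCMField ↥(K₁ ⊔ K₂) :=
      isCMField_sup_of_le_cyclotomic (μ := μ) Nat.prime_two hq (Ne.symm hq2) (by omega) hν Lm Ln K₁ K₂ h₁ h₂
    IsCMField.indexRealUnits ↥(K₁ ⊔ K₂) = 2 := by
  haveI : IsCMField ↥(K₁ ⊔ K₂) :=
    isCMField_sup_of_le_cyclotomic (μ := μ) Nat.prime_two hq (Ne.symm hq2) (by omega) hν Lm Ln K₁ K₂ h₁ h₂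
  by_cases hi : ∃ x ∈ K₁, x ^ 2 = -1
  · exact indexRealUnits_sup_eq_two_of_sq_eq_neg_one hμ hq hq2 hν Lm Ln K₁ K₂ h₁ h₂ hi
  · exact indexRealUnits_sup_eq_two_of_not_sq_tct hμ hq hq2 hν Lm Ln K₁ K₂ h₁ h₂ hi

/-- **(12c) PROPOSITION 1 h) AS STATED — ALL CASES, ANY AMBIENT FIELD: `Q(K₁K₂) = 2`** (`p ≠ q` primes labelled with
`q ≠ 2`, `μ, ν > 0`; `M` any number field, `Lm, Ln ≤ M` `{p^μ}`-, `{q^ν}`-cyclotomic over `ℚ`, `K₁ ≤ Lm`, `K₂ ≤ Ln`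
totally complex (“abelian CM-fields”, (D79)); CM structure (12a) by `haveI`).  `p` odd: item (11c); `p = 2`: `μ ≥ 2`
is forced (`ℚ(ζ_2) = ℚ` has no totally complex subfield: `IsTotallyComplex.finrank` is even and positive) and item
(12b) applies.  (D79), (D80), (D82).
[cite: Lemmermeyer1995, §2 Proposition 1 h) (« h) (see Example 4 below) Let $K_1 \subseteq \Q(\zeta_m)$ and
$K_2 \subseteq \Q(\zeta_n)$ be abelian CM-fields, where $m=p^\mu$
and $n=q^\nu$ are prime powers such that $p \ne q$, and let
$K = K_1K_2$; then $Q(K) = 2$. »); proved here] -/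
theorem indexRealUnits_sup_eq_two_of_le_primePow_cyclotomic {p q μ ν : ℕ} (hp : p.Prime) (hq : q.Prime)
    (hq2 : q ≠ 2) (hpq : p ≠ q) (hμ : 0 < μ) (hν : 0 < ν) (Lm Ln K₁ K₂ : IntermediateField ℚ M)
    [IsCyclotomicExtension {p ^ μ} ℚ Lm] [IsCyclotomicExtension {q ^ ν} ℚ Ln] (h₁ : K₁ ≤ Lm) (h₂ : K₂ ≤ Ln)
    [IsTotallyComplex K₁] [IsTotallyComplex K₂] :
    haveI : IsCMField ↥(K₁ ⊔ K₂) := isCMField_sup_of_le_cyclotomic hp hq hpq hμ hν Lm Ln K₁ K₂ h₁ h₂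
    IsCMField.indexRealUnits ↥(K₁ ⊔ K₂) = 2 := by
  haveI : IsCMField ↥(K₁ ⊔ K₂) := isCMField_sup_of_le_cyclotomic hp hq hpq hμ hν Lm Ln K₁ K₂ h₁ h₂
  by_cases hp2 : p = 2
  · subst hp2
    have hμ2 : 2 ≤ μ := by
      by_contra hlt
      have hμ1 : μ = 1 := by omega
      subst hμ1
      haveI : NeZero ((2 : ℕ) ^ 1) := ⟨by norm_num⟩
      have hLm : Module.finrank ℚ ↥Lm = 1 := by
        rw [IsCyclotomicExtension.finrank (n := 2 ^ 1) ↥Lm (Polynomial.cyclotomic.irreducible_rat (by norm_num))]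
        decide
      have hK₁ := IntermediateField.finrank_le_of_le_right h₁
      have hev : Module.finrank ℚ ↥K₁ = 2 * InfinitePlace.nrComplexPlaces ↥K₁ :=
        IsTotallyComplex.finrank ↥K₁
      have hpos : 0 < Module.finrank ℚ ↥K₁ := Module.finrank_pos
      omega
    exact indexRealUnits_sup_eq_two_of_le_twoPow_cyclotomic hμ2 hq hq2 hν Lm Ln K₁ K₂ h₁ h₂
  · exact indexRealUnits_sup_eq_two_of_cyclotomic' hp hq hp2 hq2 hpq hμ hν Lm Ln K₁ K₂ h₁ h₂

/-- **(12d) `κ_{K₁K₂/(K₁K₂)⁺} = 1` FOR EVERY COMPOSITUM OF PROPOSITION 1 h)** (setting of (12c)): the capitulation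
kernel `ker(Cl((K₁K₂)⁺) → Cl(K₁K₂))` is trivial, by (12c) and Proposition 1 b) (M107
`ker_classGroupExtendedHom_eq_bot_of_indexRealUnits_eq_two`).  So every such CM pair `(Ė, Ė⁺)`, `Ė = K₁K₂`, lies in
the regime `Q(Ė) = 2 ∨ κ ≠ 1` of M107/M109 (module docstring, WHAT THIS DECIDES).
[cite: Lemmermeyer1995, §2 Proposition 1 b) (« b) (Satz 16, 17) if $Q(L) = 2$ then $\kappa_{L/L^+} = 1$; ») with h) (« h) (see Example 4 below) Let $K_1 \subseteq \Q(\zeta_m)$ and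
$K_2 \subseteq \Q(\zeta_n)$ be abelian CM-fields, where $m=p^\mu$
and $n=q^\nu$ are prime powers such that $p \ne q$, and let
$K = K_1K_2$; then $Q(K) = 2$. »); proved here] -/
theorem ker_classGroupExtendedHom_maximalRealSubfield_sup_eq_bot_of_le_primePow_cyclotomic {p q μ ν : ℕ}
    (hp : p.Prime) (hq : q.Prime) (hq2 : q ≠ 2) (hpq : p ≠ q) (hμ : 0 < μ) (hν : 0 < ν)
    (Lm Ln K₁ K₂ : IntermediateField ℚ M) [IsCyclotomicExtension {p ^ μ} ℚ Lm]
    [IsCyclotomicExtension {q ^ ν} ℚ Ln] (h₁ : K₁ ≤ Lm) (h₂ : K₂ ≤ Ln) [IsTotallyComplex K₁]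
    [IsTotallyComplex K₂] :
    haveI : IsCMField ↥(K₁ ⊔ K₂) := isCMField_sup_of_le_cyclotomic hp hq hpq hμ hν Lm Ln K₁ K₂ h₁ h₂
    (ClassGroup.extendedHom (𝓞 (maximalRealSubfield ↥(K₁ ⊔ K₂))) (𝓞 ↥(K₁ ⊔ K₂))).ker = ⊥ := by
  haveI : IsCMField ↥(K₁ ⊔ K₂) := isCMField_sup_of_le_cyclotomic hp hq hpq hμ hν Lm Ln K₁ K₂ h₁ h₂
  exact ker_classGroupExtendedHom_eq_bot_of_indexRealUnits_eq_two (IsCMField.complexConj ↥(K₁ ⊔ K₂))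
    (Algebra.IsQuadraticExtension.finrank_eq_two (maximalRealSubfield ↥(K₁ ⊔ K₂)) ↥(K₁ ⊔ K₂))
    (IsCMField.complexConj_ne_one ↥(K₁ ⊔ K₂)) inferInstance
    (indexRealUnits_sup_eq_two_of_le_primePow_cyclotomic hp hq hq2 hpq hμ hν Lm Ln K₁ K₂ h₁ h₂)

end SqrtNotMem

end Literature.NumberTheory.Automorphic.Arthur2013.Leaves.TECR.TorusDict
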